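import Literature.AlgebraicGeometry.Resolution.RankOneReduction
import Literature.AlgebraicGeometry.Resolution.CompositeValuations
import Mathlib.RingTheory.Localization.Submodule
import Mathlib.RingTheory.Ideal.Quotient.Operations
import Mathlib.RingTheory.Localization.AsSubring
import Mathlib.RingTheory.Ideal.Height
import Mathlib.RingTheory.Localization.Ideal
import HarnessLib

/-!
# Novacoski–Spivakovsky's reduction of local uniformization to rank one: proof of Thm. 1.1

Topic: `Literature/AlgebraicGeometry/Resolution`. DISCHARGE of the named fact
`NovacoskiSpivakovsky2014` of `RankOneReduction.lean` (Thm. 1.1 of the paper, for the category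
of local domains essentially of finite type over a field `k`, in the finitely-generated-subalgebra
language of `RelLocalUniformization`): `NovacoskiSpivakovsky2014_holds`, proved in full. The
valuation-theoretic glue (composite valuations, finiteness of the rank over an affine model,
rank one = exactly two overrings) is `CompositeValuations.lean`; this file carries out the
paper's §2–§3: the two lifting steps Cor. 2.14 and Cor. 2.17, the final step of §3.1 with
Lemmas 2.18, 2.19, and the induction on the rank. It introduces no definitions.

## Dictionary (paper ↔ Lean)

Throughout `k ⊆ O ≤ O₁` are valuation rings of `K` (`ν = ν_O`, `ν₁ = ν_{O₁}`, so `ν = ν₁ ∘ ν₂`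
with `ν₂` the valuation of `κ(O₁)` with ring `residueValuationSubring O O₁ _`), and
`A ⊆ O` is a finitely generated `k`-subalgebra of `K` with `Frac A = K` (an affine model),
`h : A.toSubring ≤ O.toSubring`.
* the centre `m ∩ A` of `ν` on `A` (Def. 2.1) ↔ `(maximalIdeal O).comap (Subring.inclusion h)`,
  literally the prime of `RelLocalUniformization` (it is `centreIdeal A O h` of
  `LocalUniformization.lean` by `rfl`; we keep the shape of the fact being discharged and do
  not introduce a second name);
* the local ring `(R, m)` of the paper ↔ `Localization.AtPrime (that prime)`, realised inside
  `K` (Def. 2.8: `R⁽¹⁾ = R'_{m'} ⊆ K`) as Mathlib's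
  `Localization.subalgebra.ofField K (that prime).primeCompl _`;
* the centre `p = m_{ν₁} ∩ R` of `ν₁`, `R_p`, `R / p` ↔ the same with `O₁`, and
  `Localization.AtPrime (centre of ν) ⧸ (centre of ν₁)·`;
* the residue map `Φ : R → κ(O₁)` of Lemma 2.15 ↔ `(residue O₁).comp (Subring.inclusion _)`;
* "a finite sequence of local blowing ups w.r.t. `ν` ending in a ring with property Π"
  ↔ "a finitely generated `A' ⊇ A` inside `O` whose localisation at the centre has Π"
  (Def. 2.8 + Lemma 2.5 (1), see the module docstring of `RankOneReduction.lean`).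

## The argument (§3.1) and the content of this file

Induction on the rank of `ν`, i.e. on the number of overrings of `O` (finite over an affine
model, `finite_overrings_of_fg`). Rank `0`: `relLocalUniformization_top`. Rank `1`: the
hypothesis (`nonempty_rankOne_of_overrings`). Rank `≥ 2`: pick `O < O₁ < K`, so `ν = ν₁ ∘ ν₂`
with `ν₁`, `ν₂` of smaller rank (`card_overrings_ofPrime_lt`, `card_overrings_residue_lt`,
`card_overrings_comap_le`), and, for an affine model `R ⊆ O`:
1. `novacoskiSpivakovsky2014_cor214` — **Cor. 2.14** (with Lemma 2.12, Cor. 2.13), PROVED: local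
   uniformization of `ν₁` gives `A₁ ⊇ R` in `O` with `(A₁)_p` regular (a `ν₁`-uniformizing model
   `k[f_1, …, f_m] ⊆ O₁` is replaced by `R[g_1, …, g_m] ⊆ O`, `g_i = f_i` or `f_i⁻¹ ∈ m_O`; the
   `f_i ∉ O` are `ν₁`-units, so the local ring at the centre of `ν₁` is unchanged, Lemma 2.5 (1):
   `centreLocalization_le`, `isRegularLocalRing_of_centreLocalization_eq`).
2. `novacoskiSpivakovsky2014_cor217` — **Cor. 2.17** (with Lemma 2.15, Def. 2.16), PROVED: local
   uniformization of `ν₂` restricted to `κ = Frac Φ(A₁) ⊆ κ(O₁)` on the model `Φ(A₁)` gives a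
   model `B = Φ(A₁)[ā_j/s̄_j]`; lifting the generators to `a_j/s_j ∈ O` (`s_j ∉ p`) gives
   `A₂ ⊇ A₁` in `O` with `(A₂)_{p} = (A₁)_p` regular and `(A₂)_q / p ≅ B_{m_{ν₂} ∩ B}` regular
   (the isomorphism is `IsLocalization.lift` of `Φ`, kernel `p·`, range `ι(B_{centre})`).
   The hypothesis `h₂` asks for a `ν₂`-uniformizing model above the residue ring `Φ(A₁)` only
   (for `ν₂` restricted to `κ = Frac Φ(A₁) → κ(O₁)`); the induction supplies it from relative
   local uniformization of all restrictions of `ν₂`.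
3. `novacoskiSpivakovsky2014_step` — **§3.1, final step** (pp. 14–15, with Lemmas 2.18, 2.19),
   PROVED: if `A_P` and `A_Q / P A_Q` are regular (`Q ⊇ P` the centres of `ν ≤ ν₁` on `A`):
   (Lemma 2.18) choose `y_1, …, y_r ∈ P` generating `P A_P`, `r = dim A_P`, and — clearing the
   denominators of generators of `P` in `P A_P = (y) A_P` — one `a ∈ A ∖ P` with `a P ⊆ (y) A`
   (the paper does this one generator `y_{r+k}` at a time, `a_k y_{r+k} + Σ b_{ik} y_i - h_k = 0`;
   since `(y) A_P = P A_P` one may take `h_k = 0` and blow up once along `(a, y_1, …, y_r)`,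
   `a = ∏ a_k`, instead of `s` times along `(a_k, y_1, …, y_r)`). The blowing up
   `A' = A[y_1/a, …, y_r/a] ⊆ O` (`ν₁(y_i/a) > 0`) has, with `J' = (y_i/a) A'`: `A' = A + J'`,
   `P ⊆ J' ⊆ P'`, hence `P' = J'` is generated by `r` elements; the residues of `A'` in `κ(O₁)`
   are those of `A` (Lemma 2.19 (i): `A'_{Q'} / P' ≅ A_Q / P` regular, `range_centreResidueLift_eq`)
   and `A'_{P'} = A_P` inside `K` (Lemma 2.19 (ii)), so `r = dim A'_{P'}`. Then the dimension
   count of p. 14 ("`r + t ≥ dim R = ht m ≥ ht p + ht (m/p) = r + t`"),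
   `isRegularLocalRing_localization_of_quotient`, shows `A'_{Q'}` regular.
4. `NovacoskiSpivakovsky2014_holds` — the induction, assembling 1–3.

Neither `O₁ ≠ O` nor `O₁ ≠ ⊤` is needed in 1–3 (at `O₁ = O`, resp. `O₁ = ⊤`, a regularity
hypothesis already is the conclusion), so they are stated without.

## Source

J. Novacoski, M. Spivakovsky, *Reduction of local uniformization to the rank one case*,
Valuation Theory in Interaction (Segovia–El Escorial 2011), EMS Ser. Congr. Rep. (2014) 404–431;
arXiv:1204.4751v1: Thm. 1.1 (p. 2), Def. 2.1, Lemma 2.3, Lemma 2.5 (p. 4), Def. 2.8 (p. 6),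
Lemma 2.12–Cor. 2.14 (pp. 8–9), Lemma 2.15–Cor. 2.17 (pp. 10–11), Lemmas 2.18, 2.19
(pp. 11–13), Def. 2.20 (p. 13), §3.1 (pp. 13–15).

## Design notes

* Everything is phrased for `k K : Type`, exactly like `NovacoskiSpivakovsky2014`, over the
  subrings `A.toSubring` (the carrier of the prime in `RelLocalUniformization`).
* `isFractionRing_subalgebra_of_le` is the `k`-subalgebra variant of Mathlib's
  `instance (S : Subalgebra A K) : IsFractionRing S K` (`Mathlib.RingTheory.Localization.AsSubring`,
  for `A`-subalgebras of `Frac A`): here the smaller ring is itself a `k`-subalgebra `R ≤ A`.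
* The pull-back `{x ∈ O₁ | residue x ∈ S'}` of a subring `S' ⊆ κ(O₁)` is written with Mathlib's
  `Subring.comap`/`Subring.map` (`(S'.comap (residue O₁)).map O₁.toSubring.subtype`); for
  `S'` a valuation subring this is the subring underlying `residueOverringLift` of
  `CompositeValuations.lean`.

## Generality

Nothing in the three steps Cor. 2.14, Cor. 2.17, §3.1 uses that the base `k` is a field: they
are stated for `k`-subalgebras of a field `K` over an arbitrary commutative ring `k` mapping to
`K` (Noetherian in the final step, for Noetherianity of finitely generated models), in arbitrary
universes, and with the local-uniformization INPUT of each step being exactly the one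
uniformizing model it consumes (`h₁`: a regular model of `ν₁` above the given model; `h₂`: a
regular model of `ν₂` above the residue ring `φ(A) ≅ A/p` inside `κ(O₁)`) rather than the
blanket `RelLocalUniformization`, so that other sources of these models can be plugged in
(resolution of excellent surfaces over Cossart–Piltant's base `S`,
`ArithmeticalThreefoldsLocalRankReduction.lean`). The discharge `NovacoskiSpivakovsky2014_holds`
specialises to a base field in universe `0`, feeding both inputs from the induction hypothesis.
-/

noncomputable section

open IsLocalRing

namespace Literature.AlgebraicGeometry.Resolution

universe u v

/-! ### The centre of a valuation ring on an affine model -/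

section centre

variable {k : Type u} {K : Type v} [CommRing k] [Field K] [Algebra k K]

/-- Membership in the centre: `a ∈ m_O ∩ A ↔ ν(a) < 1`. [folklore] -/
private theorem mem_centre_iff_lt_one (O : ValuationSubring K) (A : Subalgebra k K)
    (h : A.toSubring ≤ O.toSubring) (a : A.toSubring) :
    a ∈ ((maximalIdeal O).comap (Subring.inclusion h)) ↔ O.valuation a < 1 := by
  rw [Ideal.mem_comap, ValuationSubring.valuation_lt_one_iff]
  rfl

/-- The centre of a coarsening is smaller: `m_{O₁} ∩ A ⊆ m_O ∩ A` for `O ≤ O₁`. [folklore] -/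
theorem centre_mono (O O₁ : ValuationSubring K) (hO : O ≤ O₁) (A : Subalgebra k K)
    (h : A.toSubring ≤ O.toSubring) :
    ((maximalIdeal O₁).comap (Subring.inclusion (h.trans hO)))
        ≤ ((maximalIdeal O).comap (Subring.inclusion h)) := by
  intro a ha
  rw [Ideal.mem_comap] at ha ⊢
  have := mem_of_mem_maximalIdeal_of_le O O₁ hO _ ha
  rw [mem_maximalIdeal, mem_nonunits_iff]
  intro hu
  apply ha
  exact (Units.map (O.inclusion O₁ hO).toMonoidHom hu.unit).isUnit

/-- An intermediate ring between a domain and its fraction field has the same fraction field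
(the `k`-subalgebra variant of Mathlib's `instance (S : Subalgebra A K) : IsFractionRing S K`
of `Mathlib.RingTheory.Localization.AsSubring`, which is stated for `A`-subalgebras of
`Frac A`). [folklore] -/
theorem isFractionRing_subalgebra_of_le (R A : Subalgebra k K) (hRA : R ≤ A) [IsFractionRing R K] :
    IsFractionRing A K := by
  apply IsFractionRing.of_field
  intro z
  obtain ⟨x, y, -, rfl⟩ := IsFractionRing.div_surjective (A := R) z
  exact ⟨⟨x, hRA x.2⟩, ⟨y, hRA y.2⟩, rfl⟩

end centre

section rankZero

variable {k K : Type} [Field k] [Field K] [Algebra k K]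

/-- **Rank zero.** The trivial valuation ring `O = K` admits relative local uniformization: the
localisation of a model at the centre `(0)` is the field `K`. [folklore] -/
theorem relLocalUniformization_top : RelLocalUniformization k K ⊤ := by
  intro R hR hfrac hRO
  refine ⟨R, hRO, le_rfl, hR, ?_⟩
  have hbot : Ideal.comap (Subring.inclusion hRO)
      (maximalIdeal (⊤ : ValuationSubring K)) = ⊥ := by
    rw [maximalIdeal_eq_bot, Ideal.comap_bot_of_injective]
    exact Subring.inclusion_injective _
  haveI : IsNoetherianRing R.toSubring := isNoetherianRing_of_fg hR
  suffices h : ∀ (I : Ideal R.toSubring) [I.IsPrime], I = ⊥ →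
      IsRegularLocalRing (Localization.AtPrime I) from h _ hbot
  intro I _ hI
  subst hI
  apply IsRegularLocalRing.of_spanFinrank_maximalIdeal_le
  have hm : maximalIdeal (Localization.AtPrime (⊥ : Ideal R.toSubring)) = ⊥ := by
    rw [← Localization.AtPrime.map_eq_maximalIdeal, Ideal.map_bot]
  rw [hm, Submodule.spanFinrank_bot]
  exact ringKrullDim_nonneg_of_nontrivial

end rankZero

/-! ### An overring strictly between `O` and `K` -/

section overrings

variable {K : Type v} [Field K]

/-- If `O.ofPrime p = O₁ ≠ O` then `p` is not the maximal ideal. [folklore] -/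
theorem idealOfLE_ne_maximalIdeal (O O₁ : ValuationSubring K) (hO : O ≤ O₁) (hne : O₁ ≠ O) :
    O.idealOfLE O₁ hO ≠ maximalIdeal O := by
  suffices h : ∀ (p : Ideal O) [p.IsPrime], O.ofPrime p = O₁ → p ≠ maximalIdeal O from
    h _ (ValuationSubring.ofPrime_idealOfLE O O₁ hO)
  intro p _ hp heq
  subst heq
  simp only [ValuationSubring.ofPrime_top] at hp
  exact hne hp.symm

end overrings

/-! ### The local ring of a model at the centre, inside `K` (Lemma 2.5) -/

section lifting

variable {k : Type u} {K : Type v} [CommRing k] [Field K] [Algebra k K]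

/-- `s ∈ B` lies outside the centre of `O'` iff it is a unit of `O'`, iff `ν'(s) = 1`.
[folklore] -/
theorem mem_primeCompl_centre_iff (O' : ValuationSubring K) (B : Subalgebra k K)
    (h : B.toSubring ≤ O'.toSubring) (s : B.toSubring) :
    s ∈ ((maximalIdeal O').comap (Subring.inclusion h)).primeCompl ↔ O'.valuation s = 1 := by
  rw [Ideal.mem_primeCompl_iff, mem_centre_iff_lt_one]
  have := O'.valuation_le_one ⟨s, h s.2⟩
  constructor
  · intro hs; exact le_antisymm this (not_lt.mp hs)
  · intro hs; rw [hs]; exact lt_irrefl _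

/-- Membership in the local ring at the centre realised inside `K`: fractions `a / s` with
`a, s ∈ B`, `ν'(s) = 1`.
[folklore] -/
theorem mem_centreLocalization_iff (O' : ValuationSubring K) (B : Subalgebra k K)
    (h : B.toSubring ≤ O'.toSubring) [IsFractionRing B.toSubring K] (x : K) :
    x ∈ (Localization.subalgebra.ofField K
        ((maximalIdeal O').comap (Subring.inclusion h)).primeCompl
        (Ideal.primeCompl_le_nonZeroDivisors _)) ↔
      ∃ a ∈ B, ∃ s ∈ B, O'.valuation s = 1 ∧ x = a * s⁻¹ := by
  change (∃ (a s : B.toSubring) (_ : s ∈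
      ((maximalIdeal O').comap (Subring.inclusion h)).primeCompl),
    x = algebraMap B.toSubring K a * (algebraMap B.toSubring K s)⁻¹) ↔ _
  constructor
  · rintro ⟨a, s, hs, rfl⟩
    exact ⟨a, a.2, s, s.2, (mem_primeCompl_centre_iff O' B h s).mp hs, rfl⟩
  · rintro ⟨a, ha, s, hs, hs1, rfl⟩
    exact ⟨⟨a, ha⟩, ⟨s, hs⟩, (mem_primeCompl_centre_iff O' B h ⟨s, hs⟩).mpr hs1, rfl⟩

/-- The model lies in its localisation. [folklore] -/
theorem le_centreLocalization (O' : ValuationSubring K) (B : Subalgebra k K)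
    (h : B.toSubring ≤ O'.toSubring) [IsFractionRing B.toSubring K] :
    (B : Set K) ⊆ (Localization.subalgebra.ofField K
        ((maximalIdeal O').comap (Subring.inclusion h)).primeCompl
        (Ideal.primeCompl_le_nonZeroDivisors _)) := by
  intro x hx
  rw [SetLike.mem_coe, mem_centreLocalization_iff]
  exact ⟨x, hx, 1, B.one_mem, by simp, by simp⟩

/-- Regularity of the local ring at the centre can be read off inside `K`. [folklore] -/
theorem isRegularLocalRing_iff_centreLocalization (O' : ValuationSubring K) (B : Subalgebra k K)
    (h : B.toSubring ≤ O'.toSubring) [IsFractionRing B.toSubring K] :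
    IsRegularLocalRing (Localization.AtPrime ((maximalIdeal O').comap (Subring.inclusion h))) ↔
      IsRegularLocalRing ((Localization.subalgebra.ofField K
          ((maximalIdeal O').comap (Subring.inclusion h)).primeCompl
          (Ideal.primeCompl_le_nonZeroDivisors _))) := by
  let e := (IsLocalization.algEquiv ((maximalIdeal O').comap (Subring.inclusion h)).primeCompl
    (Localization.AtPrime ((maximalIdeal O').comap (Subring.inclusion h)))
        ((Localization.subalgebra.ofField K
        ((maximalIdeal O').comap (Subring.inclusion h)).primeCompl
        (Ideal.primeCompl_le_nonZeroDivisors _)))).toRingEquiv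
  exact ⟨fun _ => .of_ringEquiv e, fun _ => .of_ringEquiv e.symm⟩

/-- **Domination** (Novacoski–Spivakovsky 2014, Lemma 2.5 (1)): if the model `B` lies in the
local ring of the model `C` at the centre of `ν'`, so does the local ring of `B`.
[cite: NovacoskiSpivakovsky2014, Lemma 2.5 (1)] -/
theorem centreLocalization_le (O' : ValuationSubring K) (B C : Subalgebra k K)
    (hB : B.toSubring ≤ O'.toSubring) (hC : C.toSubring ≤ O'.toSubring)
    [IsFractionRing B.toSubring K] [IsFractionRing C.toSubring K]
    (hBC : (B : Set K) ⊆ (Localization.subalgebra.ofField K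
        ((maximalIdeal O').comap (Subring.inclusion hC)).primeCompl
        (Ideal.primeCompl_le_nonZeroDivisors _))) :
    ((Localization.subalgebra.ofField K ((maximalIdeal O').comap (Subring.inclusion hB)).primeCompl
        (Ideal.primeCompl_le_nonZeroDivisors _)) : Set K)
        ⊆ (Localization.subalgebra.ofField K
        ((maximalIdeal O').comap (Subring.inclusion hC)).primeCompl
        (Ideal.primeCompl_le_nonZeroDivisors _)) := by
  intro x hx
  rw [SetLike.mem_coe, mem_centreLocalization_iff] at hx ⊢
  obtain ⟨a, ha, s, hs, hs1, rfl⟩ := hx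
  have ha' := hBC ha
  have hs' := hBC hs
  rw [SetLike.mem_coe, mem_centreLocalization_iff] at ha' hs'
  obtain ⟨a₁, ha₁, s₁, hs₁, hs₁1, rfl⟩ := ha'
  obtain ⟨a₂, ha₂, s₂, hs₂, hs₂1, hs⟩ := hs'
  -- `s = a₂ / s₂` is a `ν'`-unit, hence so is `a₂`, and `x = (a₁ s₂) / (s₁ a₂)`.
  have ha₂1 : O'.valuation a₂ = 1 := by
    have := congrArg O'.valuation hs
    rw [hs1, map_mul, map_inv₀, hs₂1, inv_one, mul_one] at this
    exact this.symm
  refine ⟨a₁ * s₂, C.mul_mem ha₁ hs₂, s₁ * a₂, C.mul_mem hs₁ ha₂, by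
    rw [map_mul, hs₁1, ha₂1, mul_one], ?_⟩
  have hs₁0 : s₁ ≠ 0 := by rintro rfl; simp at hs₁1
  have ha₂0 : a₂ ≠ 0 := by rintro rfl; simp at ha₂1
  have hs₂0 : s₂ ≠ 0 := by rintro rfl; simp at hs₂1
  rw [hs]
  field_simp

/-- Transfer of regularity along equal realisations inside `K`. [folklore] -/
theorem isRegularLocalRing_of_centreLocalization_eq (O' : ValuationSubring K)
    (B C : Subalgebra k K) (hB : B.toSubring ≤ O'.toSubring) (hC : C.toSubring ≤ O'.toSubring)
    [IsFractionRing B.toSubring K] [IsFractionRing C.toSubring K]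
    (heq : ((Localization.subalgebra.ofField K
        ((maximalIdeal O').comap (Subring.inclusion hB)).primeCompl
        (Ideal.primeCompl_le_nonZeroDivisors _)) : Set K)
        = (Localization.subalgebra.ofField K
        ((maximalIdeal O').comap (Subring.inclusion hC)).primeCompl
        (Ideal.primeCompl_le_nonZeroDivisors _)))
    (hreg : IsRegularLocalRing
        (Localization.AtPrime ((maximalIdeal O').comap (Subring.inclusion hC)))) :
    IsRegularLocalRing (Localization.AtPrime ((maximalIdeal O').comap (Subring.inclusion hB))) := by
  rw [isRegularLocalRing_iff_centreLocalization] at hreg ⊢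
  have heq' : ((Localization.subalgebra.ofField K
      ((maximalIdeal O').comap (Subring.inclusion hC)).primeCompl
      (Ideal.primeCompl_le_nonZeroDivisors _))).toSubring
      = ((Localization.subalgebra.ofField K
      ((maximalIdeal O').comap (Subring.inclusion hB)).primeCompl
      (Ideal.primeCompl_le_nonZeroDivisors _))).toSubring :=
    SetLike.coe_injective heq.symm
  exact .of_ringEquiv (RingEquiv.subringCongr heq')

/-! ### Cor. 2.14 -/

/-- **Novacoski–Spivakovsky 2014, Cor. 2.14** (with Lemma 2.12, Cor. 2.13: lifting blowing ups
of `R_p` along `ν₁` to blowing ups of `R` along `ν`). Printed statement: "Let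
`R_p → R̃⁽¹⁾ → ⋯ → R̃⁽ʳ⁾` be a sequence of local blowing ups with respect to `ν₁`. Then there exists
a sequence of local blowing ups `R → R⁽¹⁾ → ⋯ → R⁽ⁿ⁾` with respect to `ν` such that
`R⁽ⁿ⁾_{p⁽ⁿ⁾} = R̃⁽ʳ⁾`, where `p⁽ⁿ⁾` is the centre of `ν₁` in `R⁽ⁿ⁾`. In particular, if `R̃⁽ʳ⁾` is
regular then `R⁽ⁿ⁾_{p⁽ⁿ⁾}` is regular." PROVED here for affine models over a base ring `k` (see
the module docstring), keeping the "in particular": for `ν = ν₁ ∘ ν₂` on `K` (`O ≤ O₁`), if the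
affine model `R ⊆ O` lies in a finitely generated `ν₁`-uniformizing model `A₁ ⊆ O₁`
(hypothesis `h₁`, e.g. from relative local uniformization of `ν₁`), then `R` is dominated by a
finitely generated `A ⊆ O` whose localisation at the centre of `ν₁` is regular. Proof by the
device of Lemma 2.12: a `ν₁`-uniformizing model `A₁ = k[f_1, …, f_m] ⊆ O₁` is replaced by
`A = R[g_1, …, g_m] ⊆ O` with `g_i = f_i` if `f_i ∈ O` and `g_i = f_i⁻¹ ∈ m_O` otherwise; then
`f_i` is a `ν₁`-unit and `A`, `A₁` have the same local ring at the centre of `ν₁`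
(Lemma 2.5 (1)). [cite: NovacoskiSpivakovsky2014, Cor. 2.14] -/
theorem novacoskiSpivakovsky2014_cor214 (O O₁ : ValuationSubring K) (hO : O ≤ O₁)
    (R : Subalgebra k K) (hR : R.FG) (hfrac : IsFractionRing R K)
    (hRO : R.toSubring ≤ O.toSubring)
    (h₁ : ∃ (A₁ : Subalgebra k K) (hA₁ : A₁.toSubring ≤ O₁.toSubring), R ≤ A₁ ∧ A₁.FG ∧
      IsRegularLocalRing
        (Localization.AtPrime ((maximalIdeal O₁).comap (Subring.inclusion hA₁)))) :
    ∃ (A : Subalgebra k K) (hA : A.toSubring ≤ O.toSubring), R ≤ A ∧ A.FG ∧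
      IsRegularLocalRing
        (Localization.AtPrime ((maximalIdeal O₁).comap (Subring.inclusion (hA.trans hO)))) := by
  classical
  obtain ⟨A₁, hA₁, hRA₁, hA₁fg, hreg₁⟩ := h₁
  obtain ⟨t, ht⟩ := hA₁fg
  have hk : ∀ c : k, algebraMap k K c ∈ O := fun c => hRO (R.algebraMap_mem c)
  let Ok : Subalgebra k K := ({ O.toSubring with algebraMap_mem' := hk } : Subalgebra k K)
  -- the modified generators and the new model
  let g : K → K := fun f => if f ∈ O then f else f⁻¹
  have hg : ∀ f, g f ∈ O := by
    intro f
    by_cases hf : f ∈ O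
    · simp [g, hf]
    · simp only [g, hf, if_false]; exact (O.mem_or_inv_mem f).resolve_left hf
  let A : Subalgebra k K := R ⊔ Algebra.adjoin k (t.image g : Set K)
  have hAOk : A ≤ Ok := by
    refine sup_le (fun x hx => hRO hx) (Algebra.adjoin_le ?_)
    intro x hx
    rw [Finset.coe_image] at hx
    obtain ⟨f, -, rfl⟩ := hx
    exact hg f
  have hAO : A.toSubring ≤ O.toSubring := fun x hx => hAOk hx
  have hRA : R ≤ A := le_sup_left
  refine ⟨A, hAO, hRA, hR.sup ⟨_, rfl⟩, ?_⟩
  haveI := hfrac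
  haveI : IsFractionRing A.toSubring K := isFractionRing_subalgebra_of_le R A hRA
  haveI : IsFractionRing A₁.toSubring K := isFractionRing_subalgebra_of_le R A₁ hRA₁
  -- generators `f ∉ O` are `ν₁`-units
  have hunit : ∀ f ∈ t, f ∉ O → O₁.valuation f = 1 := by
    intro f hft hfO
    have hf1 : f ∈ A₁ := by rw [← ht]; exact Algebra.subset_adjoin hft
    have hfi : f⁻¹ ∈ O := (O.mem_or_inv_mem f).resolve_left hfO
    have hf0 : f ≠ 0 := by rintro rfl; exact hfO O.zero_mem
    apply le_antisymm ((O₁.valuation_le_one_iff f).mpr (hA₁ hf1))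
    have := (O₁.valuation_le_one_iff f⁻¹).mpr (hO hfi)
    rwa [map_inv₀, inv_le_one₀ ((Valuation.pos_iff _).mpr hf0)] at this
  -- `A₁ ⊆ L(A)` and `A ⊆ L(A₁)` for the local rings at the centre of `ν₁`
  have hAO₁ : A.toSubring ≤ O₁.toSubring := hAO.trans hO
  let LA : Subalgebra k K :=
    { ((Localization.subalgebra.ofField K
        ((maximalIdeal O₁).comap (Subring.inclusion hAO₁)).primeCompl
        (Ideal.primeCompl_le_nonZeroDivisors _))).toSubring with
      algebraMap_mem' := fun c => le_centreLocalization O₁ A hAO₁ (A.algebraMap_mem c) }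
  let LA₁ : Subalgebra k K :=
    { ((Localization.subalgebra.ofField K
        ((maximalIdeal O₁).comap (Subring.inclusion hA₁)).primeCompl
        (Ideal.primeCompl_le_nonZeroDivisors _))).toSubring with
      algebraMap_mem' := fun c => le_centreLocalization O₁ A₁ hA₁ (A₁.algebraMap_mem c) }
  have h1 : A₁ ≤ LA := by
    rw [← ht]
    refine Algebra.adjoin_le fun f hft => ?_
    change f ∈ (Localization.subalgebra.ofField K
        ((maximalIdeal O₁).comap (Subring.inclusion hAO₁)).primeCompl
        (Ideal.primeCompl_le_nonZeroDivisors _))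
    rw [mem_centreLocalization_iff]
    by_cases hfO : f ∈ O
    · refine ⟨f, ?_, 1, A.one_mem, by simp, by simp⟩
      apply Algebra.subset_adjoin (R := k) |>.trans (le_sup_right (a := R)) |> fun h => h ?_
      rw [Finset.coe_image]; exact ⟨f, hft, by simp [g, hfO]⟩
    · have hf0 : f ≠ 0 := by rintro rfl; exact hfO O.zero_mem
      refine ⟨1, A.one_mem, f⁻¹, ?_, ?_, by simp⟩
      · apply (le_sup_right (a := R) : Algebra.adjoin k _ ≤ A)
        apply Algebra.subset_adjoin
        rw [Finset.coe_image]; exact ⟨f, hft, by simp [g, hfO]⟩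
      · rw [map_inv₀, hunit f hft hfO, inv_one]
  have h2 : A ≤ LA₁ := by
    refine sup_le (fun x hx => ?_) (Algebra.adjoin_le fun x hx => ?_)
    · exact le_centreLocalization O₁ A₁ hA₁ (hRA₁ hx)
    · rw [Finset.coe_image] at hx
      obtain ⟨f, hft, rfl⟩ := hx
      have hf1 : f ∈ A₁ := by rw [← ht]; exact Algebra.subset_adjoin hft
      change g f ∈ (Localization.subalgebra.ofField K
          ((maximalIdeal O₁).comap (Subring.inclusion hA₁)).primeCompl
          (Ideal.primeCompl_le_nonZeroDivisors _))
      by_cases hfO : f ∈ O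
      · simp only [g, hfO, if_true]
        exact le_centreLocalization O₁ A₁ hA₁ hf1
      · simp only [g, hfO, if_false]
        rw [mem_centreLocalization_iff]
        exact ⟨1, A₁.one_mem, f, hf1, hunit f hft hfO, by simp⟩
  have heq : ((Localization.subalgebra.ofField K
      ((maximalIdeal O₁).comap (Subring.inclusion hAO₁)).primeCompl
      (Ideal.primeCompl_le_nonZeroDivisors _)) : Set K)
      = (Localization.subalgebra.ofField K
      ((maximalIdeal O₁).comap (Subring.inclusion hA₁)).primeCompl
      (Ideal.primeCompl_le_nonZeroDivisors _)) := by
    apply le_antisymm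
    · exact centreLocalization_le O₁ A A₁ hAO₁ hA₁ (fun x hx => h2 hx)
    · exact centreLocalization_le O₁ A₁ A hA₁ hAO₁ (fun x hx => h1 hx)
  exact isRegularLocalRing_of_centreLocalization_eq O₁ A A₁ hAO₁ hA₁ heq hreg₁

/-! ### Cor. 2.17: residues and lifts -/

section residues

variable (O O₁ : ValuationSubring K) (hO : O ≤ O₁)

/-- The kernel of the residue map on a model is the centre of `ν₁`. [folklore] -/
theorem residue_inclusion_eq_zero_iff (A : Subalgebra k K) (hA : A.toSubring ≤ O₁.toSubring)
    (a : A.toSubring) : ((residue O₁).comp (Subring.inclusion hA)) a = 0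
        ↔ a ∈ ((maximalIdeal O₁).comap (Subring.inclusion hA)) := by
  rw [RingHom.comp_apply, residue_eq_zero_iff, Ideal.mem_comap]

/-- Elements outside the centre of `ν₁` have unit residue. [folklore] -/
theorem isUnit_residue_inclusion (A : Subalgebra k K) (hA : A.toSubring ≤ O₁.toSubring)
    (s : A.toSubring) (hs : s ∈ ((maximalIdeal O₁).comap (Subring.inclusion hA)).primeCompl) :
        IsUnit (((residue O₁).comp (Subring.inclusion hA)) s) := by
  rw [isUnit_iff_ne_zero, ne_eq, residue_inclusion_eq_zero_iff]
  exact hs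

/-- `ν₁`-units have inverses in `O₁`. [folklore] -/
theorem inv_mem_of_valuation_eq_one {s : K} (hs1 : O₁.valuation s = 1) : s⁻¹ ∈ O₁ := by
  rw [← O₁.valuation_le_one_iff, map_inv₀, hs1, inv_one]

/-- Residue of a fraction `a / s` with `s` a `ν₁`-unit. [folklore] -/
theorem residue_div (a s : K) (ha : a ∈ O₁) (hs : s ∈ O₁) (hs1 : O₁.valuation s = 1)
    (h : a / s ∈ O₁) :
    residue O₁ ⟨a / s, h⟩ = residue O₁ ⟨a, ha⟩ / residue O₁ ⟨s, hs⟩ := by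
  have hs0 : s ≠ 0 := by rintro rfl; simp at hs1
  have hsi : s⁻¹ ∈ O₁ := inv_mem_of_valuation_eq_one O₁ hs1
  have : (⟨a / s, h⟩ : O₁) = ⟨a, ha⟩ * ⟨s⁻¹, hsi⟩ := Subtype.ext (div_eq_mul_inv a s)
  rw [this, map_mul, residue_mk_inv O₁ hs hsi hs0, div_eq_mul_inv]

include hO in
/-- For `y ∈ O`: `y` is a non-unit of `O` iff its residue is a non-unit of `O / m_{O₁}`.
[folklore] -/
theorem valuation_lt_one_iff_residue (y : K) (hy : y ∈ O) :
    O.valuation y < 1 ↔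
      (residueValuationSubring O O₁ hO).valuation (residue O₁ ⟨y, hO hy⟩) < 1 := by
  have hmem : residue O₁ ⟨y, hO hy⟩ ∈ residueValuationSubring O O₁ hO :=
    (residue_mem_residueValuationSubring_iff O O₁ hO ⟨y, hO hy⟩).mpr hy
  let yO : O := ⟨y, hy⟩
  let yb : residueValuationSubring O O₁ hO := ⟨residue O₁ ⟨y, hO hy⟩, hmem⟩
  change O.valuation (yO : K) < 1 ↔
    (residueValuationSubring O O₁ hO).valuation (yb : ResidueField O₁) < 1
  rw [← ValuationSubring.valuation_lt_one_iff, ← ValuationSubring.valuation_lt_one_iff,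
    mem_maximalIdeal, mem_maximalIdeal, mem_nonunits_iff, mem_nonunits_iff, not_iff_not]
  constructor
  · intro hu
    exact hu.map ((residue O₁).comp (O.inclusion O₁ hO)).rangeRestrict
  · intro hu
    have hne : residue O₁ ⟨y, hO hy⟩ ≠ 0 := fun h0 => hu.ne_zero (Subtype.ext h0)
    have hy0 : y ≠ 0 := by
      rintro rfl
      apply hne
      have : (⟨(0 : K), hO hy⟩ : O₁) = 0 := rfl
      rw [this, map_zero]
    have hyi : y⁻¹ ∈ O₁ := by
      by_contra hyi
      exact hne (residue_mk_eq_zero_of_inv_notMem O₁ (hO hy) hyi)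
    apply isUnit_of_inv_mem O hy ?_ hy0
    rw [← residue_mem_residueValuationSubring_iff O O₁ hO ⟨y⁻¹, hyi⟩,
      residue_mk_inv O₁ (hO hy) hyi hy0]
    exact inv_mem_of_isUnit (residueValuationSubring O O₁ hO) hmem hu

end residues

/-- Units are detected after restriction along a field embedding. [folklore] -/
theorem isUnit_comap_iff {L K₁ : Type*} [Field L] [Field K₁] (S : ValuationSubring K₁)
    (f : L →+* K₁) (b : L) (hb : b ∈ S.comap f) :
    IsUnit (⟨b, hb⟩ : S.comap f) ↔ IsUnit (⟨f b, hb⟩ : S) := by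
  constructor
  · intro hu
    obtain ⟨u, hu⟩ := hu
    have e : b * (((u⁻¹ : (S.comap f)ˣ) : S.comap f) : L) = 1 := by
      have := congrArg (fun z : S.comap f => (z : L)) u.mul_inv
      simpa [hu] using this
    refine .of_mul_eq_one ⟨f ((u⁻¹ : (S.comap f)ˣ) : S.comap f), ((u⁻¹ : (S.comap f)ˣ) :
      S.comap f).2⟩ ?_
    apply Subtype.ext
    change f b * f _ = 1
    rw [← map_mul, e, map_one]
  · intro hu
    have hb0 : f b ≠ 0 := by
      intro h0; apply hu.ne_zero; exact Subtype.ext h0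
    have hinv := inv_mem_of_isUnit S hb hu
    rw [← map_inv₀] at hinv
    exact isUnit_of_inv_mem (S.comap f) hb hinv (by rintro rfl; exact hb0 (map_zero f))

/-- In a valuation ring, `¬ ν(a) < 1` iff `a` is a unit. [folklore] -/
theorem not_valuation_lt_one_iff {K₁ : Type*} [Field K₁] (S : ValuationSubring K₁) (a : S) :
    ¬ S.valuation a < 1 ↔ IsUnit a := by
  rw [← ValuationSubring.valuation_lt_one_iff, mem_maximalIdeal, mem_nonunits_iff, not_not]

/-- Membership in the pull-back `{x ∈ O₁ | residue x ∈ S'}` to `K` of a subring `S'` of `κ(O₁)`.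
[folklore] -/
theorem mem_map_subtype_comap_residue_iff (O₁ : ValuationSubring K) (S' : Subring (ResidueField O₁))
    (x : K) : x ∈ ((S'.comap (residue O₁)).map O₁.toSubring.subtype)
        ↔ ∃ hx : x ∈ O₁, residue O₁ ⟨x, hx⟩ ∈ S' := by
  constructor
  · rintro ⟨y, hy, rfl⟩; exact ⟨y.2, hy⟩
  · rintro ⟨hx, h'⟩; exact ⟨⟨x, hx⟩, h', rfl⟩

set_option maxHeartbeats 800000 in
/-- **Novacoski–Spivakovsky 2014, Cor. 2.17** (with Lemma 2.15, Def. 2.16: lifting blowing ups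
of `R/p` along `ν₂` to blowing ups of `R` along `ν`). Printed statement: "Take a sequence of
local blowing ups `(R/p, m/p) → R̄⁽¹⁾ → ⋯ → R̄⁽ʳ⁾` with respect to `ν₂`. Then there exists a
sequence of local blowing ups `(R, m) → R⁽¹⁾ → ⋯ → R⁽ⁿ⁾` with respect to `ν` such that
`R⁽ⁿ⁾_{p⁽ⁿ⁾} = R_p` and `R⁽ⁿ⁾/p⁽ⁿ⁾ ≅ R̄⁽ʳ⁾`, where `p⁽ⁿ⁾ = R⁽ⁿ⁾ ∩ m_{ν₁}`. In particular, if `R_p`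
and `R̄⁽ʳ⁾` are regular, then so are `R⁽ⁿ⁾_{p⁽ⁿ⁾}` and `R⁽ⁿ⁾/p⁽ⁿ⁾`." PROVED here (weaker form) for
`ν = ν₁ ∘ ν₂` on `K/k` (`O ≤ O₁`) and an affine model `A ⊆ O` (`R = A` localised at the centre of
`ν`, `p` = centre of `ν₁`) with `R_p` regular: IF `ν₂` — as a valuation of the residue field
`κ(O₁)`, ring `residueValuationSubring O O₁ _` — admits relative local uniformization after
restriction to every field `κ → κ(O₁)` (the paper needs only `κ = κ(p) = Frac (R/p)`, Lemma 2.3),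
THEN some finitely generated `A' ⊇ A` inside `O` has `A'` localised at the centre of `ν₁`
regular and (`A'` localised at the centre of `ν`) modulo (the centre of `ν₁`) regular. Over a
base ring `k`, hypothesis `h₂` asks for the `ν₂`-uniformizing model only above the residue ring
`φ(A)` of the given model (`φ` the residue map into a subfield `κ` of `κ(O₁)`, `ι : κ → κ(O₁)`).
Proof (Lemma 2.15): generators `b = ā/s̄` of a `ν₂`-uniformizing model of `κ ⊆ κ(O₁)` over `Φ(A)` are
lifted to `a/s ∈ O` with `s ∉ p`; the new model `A' = A[a/s, …]` has the same local ring at the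
centre of `ν₁` (Lemma 2.5 (1)), and `A'_{m_ν ∩ A'} / (m_{ν₁} ∩ A')` is the local ring of the
`ν₂`-model at its centre, realised inside `κ(O₁)`. [cite: NovacoskiSpivakovsky2014, Cor. 2.17] -/
theorem novacoskiSpivakovsky2014_cor217 (O O₁ : ValuationSubring K) (hO : O ≤ O₁)
    (A : Subalgebra k K) (hA : A.toSubring ≤ O.toSubring) (hAfg : A.FG)
    (hfrac : IsFractionRing A K)
    (hregP : IsRegularLocalRing
      (Localization.AtPrime ((maximalIdeal O₁).comap (Subring.inclusion (hA.trans hO)))))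
    (h₂ : ∀ (κ : Type v) [Field κ] [Algebra k κ] (ι : κ →+* ResidueField O₁) (φ : A →ₐ[k] κ),
      (∀ a : A, ι (φ a) = residue O₁ ⟨(a : K), (hA.trans hO) a.2⟩) →
      IsFractionRing φ.range κ →
      ∃ (B : Subalgebra k κ)
        (hB : B.toSubring ≤ ((residueValuationSubring O O₁ hO).comap ι).toSubring),
        φ.range ≤ B ∧ B.FG ∧
        IsRegularLocalRing (Localization.AtPrime
          ((maximalIdeal ((residueValuationSubring O O₁ hO).comap ι)).comap
            (Subring.inclusion hB)))) :
    ∃ (A' : Subalgebra k K) (hA' : A'.toSubring ≤ O.toSubring), A ≤ A' ∧ A'.FG ∧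
      IsRegularLocalRing
        (Localization.AtPrime ((maximalIdeal O₁).comap (Subring.inclusion (hA'.trans hO)))) ∧
      IsRegularLocalRing
        (Localization.AtPrime ((maximalIdeal O).comap (Subring.inclusion hA')) ⧸
          ((maximalIdeal O₁).comap (Subring.inclusion (hA'.trans hO))).map
            (algebraMap A'.toSubring
              (Localization.AtPrime ((maximalIdeal O).comap (Subring.inclusion hA'))))) := by
  classical
  haveI := hfrac
  have hAO₁ : A.toSubring ≤ O₁.toSubring := hA.trans hO
  set O₂ := residueValuationSubring O O₁ hO with hO₂def
  set P := ((maximalIdeal O₁).comap (Subring.inclusion hAO₁)) with hPdef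
  let φ : A.toSubring →+* ResidueField O₁ := ((residue O₁).comp (Subring.inclusion hAO₁))
  -- the residue field `κ = Frac (A / P)` inside `κ(O₁)`, with its `k`-structure
  let κ : Subfield (ResidueField O₁) := Subfield.closure (Set.range φ)
  have hφκ : ∀ a, φ a ∈ κ := fun a => Subfield.subset_closure ⟨a, rfl⟩
  let φκ : A →+* κ := (φ.codRestrict κ.toSubring hφκ : A.toSubring →+* κ)
  letI : Algebra k κ := (φκ.comp (algebraMap k A)).toAlgebra
  let φₐ : A →ₐ[k] κ := { φκ with commutes' := fun c => rfl }
  let ι : κ →+* ResidueField O₁ := κ.subtype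
  set O₂' := O₂.comap ι with hO₂'def
  -- basic facts about `φ`
  have hφO₂ : ∀ a : A, φ a ∈ O₂ := fun a =>
    (residue_mem_residueValuationSubring_iff O O₁ hO _).mpr (hA a.2)
  have hφunit : ∀ s : A, s ∉ P → O₁.valuation (s : K) = 1 := fun s hs =>
    (mem_primeCompl_centre_iff O₁ A hAO₁ s).mp hs
  -- the model `B₀ = φ(A)` of `κ` and its properties
  let B₀ : Subalgebra k κ := φₐ.range
  have hmemB₀ : ∀ x : κ, x ∈ B₀ ↔ ∃ a : A, φκ a = x := fun x => AlgHom.mem_range φₐ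
  have hB₀O₂' : B₀.toSubring ≤ O₂'.toSubring := by
    intro x hx
    obtain ⟨a, rfl⟩ := (hmemB₀ x).mp hx
    change ι (φκ a) ∈ O₂
    exact hφO₂ a
  have hrange : (Subring.closure (Set.range φ)) = φ.range := by
    rw [← RingHom.coe_range, Subring.closure_eq]
  haveI hB₀frac : IsFractionRing B₀ κ := by
    apply IsFractionRing.of_field
    rintro ⟨z, hz⟩
    rw [Subfield.mem_closure_iff] at hz
    obtain ⟨y, hy, w, hw, rfl⟩ := hz
    rw [hrange] at hy hw
    obtain ⟨a, rfl⟩ := hy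
    obtain ⟨b, rfl⟩ := hw
    refine ⟨⟨φκ a, (hmemB₀ _).mpr ⟨a, rfl⟩⟩, ⟨φκ b, (hmemB₀ _).mpr ⟨b, rfl⟩⟩, ?_⟩
    apply Subtype.ext
    rfl
  -- local uniformization of `ν₂` on the model `B₀`
  obtain ⟨B, hB, hB₀B, hBfg, hregB⟩ := h₂ κ ι φₐ (fun _ => rfl) hB₀frac
  obtain ⟨tB, htB⟩ := hBfg
  -- lifting elements of `κ` to fractions `a / s`, `s ∉ P`
  have hlift : ∀ b : κ, ∃ a s : A, s ∉ P ∧ (b : ResidueField O₁) = φ a / φ s := by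
    rintro ⟨z, hz⟩
    rw [Subfield.mem_closure_iff] at hz
    obtain ⟨y, hy, w, hw, rfl⟩ := hz
    rw [hrange] at hy hw
    obtain ⟨a, rfl⟩ := hy
    obtain ⟨s, rfl⟩ := hw
    by_cases hs : s ∈ P
    · refine ⟨0, 1, ?_, ?_⟩
      · exact ((maximalIdeal O₁).comap (Subring.inclusion hAO₁)).primeCompl.one_mem
      · have : φ s = 0 := (residue_inclusion_eq_zero_iff O₁ A hAO₁ s).mpr hs
        simp [this]
    · exact ⟨a, s, hs, rfl⟩
  choose fa fs hfs hlift using hlift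
  let g : κ → K := fun b => (fa b : K) / (fs b : K)
  have hgO₁ : ∀ b, g b ∈ O₁ := fun b => by
    simp only [g, div_eq_mul_inv]
    exact mul_mem (hAO₁ (fa b).2) (inv_mem_of_valuation_eq_one O₁ (hφunit _ (hfs b)))
  have hgres : ∀ b, residue O₁ ⟨g b, hgO₁ b⟩ = (b : ResidueField O₁) := fun b => by
    rw [hlift b]
    exact residue_div O₁ _ _ (hAO₁ (fa b).2) (hAO₁ (fs b).2) (hφunit _ (hfs b)) _
  have hgO : ∀ b : κ, b ∈ B → g b ∈ O := fun b hb => by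
    rw [← residue_mem_residueValuationSubring_iff O O₁ hO ⟨g b, hgO₁ b⟩, hgres b]
    exact hB hb
  -- the new model
  let A' : Subalgebra k K := A ⊔ Algebra.adjoin k (tB.image g : Set K)
  have hk : ∀ c : k, algebraMap k K c ∈ O := fun c => hA (A.algebraMap_mem c)
  have htBB : ∀ b ∈ tB, b ∈ B := fun b hb => by rw [← htB]; exact Algebra.subset_adjoin hb
  have hA'O : A'.toSubring ≤ O.toSubring := by
    have : A' ≤ ({ O.toSubring with algebraMap_mem' := hk } : Subalgebra k K) := by
      refine sup_le (fun x hx => hA hx) (Algebra.adjoin_le ?_)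
      intro x hx
      rw [Finset.coe_image] at hx
      obtain ⟨b, hb, rfl⟩ := hx
      exact hgO b (htBB b hb)
    exact fun x hx => this hx
  have hAA' : A ≤ A' := le_sup_left
  have hA'fg : A'.FG := hAfg.sup ⟨_, rfl⟩
  have hA'O₁ : A'.toSubring ≤ O₁.toSubring := hA'O.trans hO
  haveI : IsFractionRing A.toSubring K := hfrac
  haveI hfrac' : IsFractionRing A'.toSubring K := isFractionRing_subalgebra_of_le A A' hAA'
  refine ⟨A', hA'O, hAA', hA'fg, ?_, ?_⟩
  · -- Claim 1: the local ring at the centre of `ν₁` is unchanged (Lemma 2.15, second part).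
    have h1 : (A' : Set K) ⊆ (Localization.subalgebra.ofField K
        ((maximalIdeal O₁).comap (Subring.inclusion hAO₁)).primeCompl
        (Ideal.primeCompl_le_nonZeroDivisors _)) := by
      refine fun x hx => (sup_le (fun x hx => le_centreLocalization O₁ A hAO₁ hx)
        (Algebra.adjoin_le ?_) : A' ≤ { ((Localization.subalgebra.ofField K
            ((maximalIdeal O₁).comap (Subring.inclusion hAO₁)).primeCompl
            (Ideal.primeCompl_le_nonZeroDivisors _))).toSubring with
          algebraMap_mem' := fun c =>
            le_centreLocalization O₁ A hAO₁ (A.algebraMap_mem c) }) hx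
      intro x hx
      rw [Finset.coe_image] at hx
      obtain ⟨b, -, rfl⟩ := hx
      change g b ∈ (Localization.subalgebra.ofField K
          ((maximalIdeal O₁).comap (Subring.inclusion hAO₁)).primeCompl
          (Ideal.primeCompl_le_nonZeroDivisors _))
      rw [mem_centreLocalization_iff]
      exact ⟨fa b, (fa b).2, fs b, (fs b).2, hφunit _ (hfs b), div_eq_mul_inv _ _⟩
    have h2 : (A : Set K) ⊆ (Localization.subalgebra.ofField K
        ((maximalIdeal O₁).comap (Subring.inclusion hA'O₁)).primeCompl
        (Ideal.primeCompl_le_nonZeroDivisors _)) :=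
      fun x hx => le_centreLocalization O₁ A' hA'O₁ (hAA' hx)
    have heq : ((Localization.subalgebra.ofField K
        ((maximalIdeal O₁).comap (Subring.inclusion hA'O₁)).primeCompl
        (Ideal.primeCompl_le_nonZeroDivisors _)) : Set K)
        = (Localization.subalgebra.ofField K
        ((maximalIdeal O₁).comap (Subring.inclusion hAO₁)).primeCompl
        (Ideal.primeCompl_le_nonZeroDivisors _)) :=
      le_antisymm (centreLocalization_le O₁ A' A hA'O₁ hAO₁ h1)
        (centreLocalization_le O₁ A A' hAO₁ hA'O₁ h2)
    exact isRegularLocalRing_of_centreLocalization_eq O₁ A' A hA'O₁ hAO₁ heq hregP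
  · -- Claim 2: `A'_{Q'} / P' A'_{Q'}` is the local ring of `B` at the centre of `ν₂`
    -- (Lemma 2.15, first part), realised inside `κ(O₁)`.
    set Q' := ((maximalIdeal O).comap (Subring.inclusion hA'O)) with hQ'def
    set P' := ((maximalIdeal O₁).comap (Subring.inclusion hA'O₁)) with hP'def
    have hP'Q' : P' ≤ Q' := centre_mono O O₁ hO A' hA'O
    let S := Localization.AtPrime Q'
    let ψ : A'.toSubring →+* ResidueField O₁ := ((residue O₁).comp (Subring.inclusion hA'O₁))
    -- `ψ(A') ⊆ ι(B)`
    have hψB : ∀ x : A'.toSubring, ∃ b : κ, b ∈ B ∧ ψ x = b := by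
      let T : Subalgebra k K :=
        { (((B.toSubring.map ι).comap (residue O₁)).map O₁.toSubring.subtype) with
          algebraMap_mem' := fun c => by
            change algebraMap k K c ∈ (((B.toSubring.map ι).comap (residue O₁)).map
                O₁.toSubring.subtype)
            rw [mem_map_subtype_comap_residue_iff]
            refine ⟨hAO₁ (A.algebraMap_mem c), ?_⟩
            rw [Subring.mem_map]
            refine ⟨φκ ⟨algebraMap k K c, A.algebraMap_mem c⟩, hB₀B ((hmemB₀ _).mpr ⟨_, rfl⟩),
              rfl⟩ }
      have hA'T : A' ≤ T := by
        refine sup_le (fun x hx => ?_) (Algebra.adjoin_le fun x hx => ?_)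
        · change x ∈ (((B.toSubring.map ι).comap (residue O₁)).map O₁.toSubring.subtype)
          rw [mem_map_subtype_comap_residue_iff]
          refine ⟨hAO₁ hx, ?_⟩
          rw [Subring.mem_map]
          exact ⟨φκ ⟨x, hx⟩, hB₀B ((hmemB₀ _).mpr ⟨_, rfl⟩), rfl⟩
        · rw [Finset.coe_image] at hx
          obtain ⟨b, hb, rfl⟩ := hx
          change g b ∈ (((B.toSubring.map ι).comap (residue O₁)).map O₁.toSubring.subtype)
          rw [mem_map_subtype_comap_residue_iff]
          refine ⟨hgO₁ b, ?_⟩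
          rw [Subring.mem_map, hgres b]
          exact ⟨b, htBB b hb, rfl⟩
      intro x
      have hx := hA'T x.2
      change (x : K) ∈ (((B.toSubring.map ι).comap (residue O₁)).map O₁.toSubring.subtype) at hx
      rw [mem_map_subtype_comap_residue_iff] at hx
      obtain ⟨hx₁, hx₂⟩ := hx
      rw [Subring.mem_map] at hx₂
      obtain ⟨b, hb, hb'⟩ := hx₂
      exact ⟨b, hb, hb'.symm⟩
    -- units: `s ∉ Q'` iff `ψ s` is a unit of `O₂`
    have hψO₂ : ∀ x : A'.toSubring, ψ x ∈ O₂ := fun x =>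
      (residue_mem_residueValuationSubring_iff O O₁ hO _).mpr (hA'O x.2)
    have hQ'iff : ∀ s : A'.toSubring, s ∉ Q' ↔ IsUnit (⟨ψ s, hψO₂ s⟩ : O₂) := by
      intro s
      rw [mem_centre_iff_lt_one, valuation_lt_one_iff_residue O O₁ hO (s : K) (hA'O s.2)]
      exact not_valuation_lt_one_iff O₂ ⟨ψ s, hψO₂ s⟩
    have hunits : ∀ s : Q'.primeCompl, IsUnit (ψ s) := fun s =>
      isUnit_residue_inclusion O₁ A' hA'O₁ s (fun h => s.2 (hP'Q' h))
    let θ : S →+* ResidueField O₁ := IsLocalization.lift hunits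
    have hθmk : ∀ (a : A'.toSubring) (s : Q'.primeCompl),
        θ (IsLocalization.mk' S a s) = ψ a / ψ s := by
      intro a s
      rw [IsLocalization.lift_mk'_spec]
      field_simp [(hunits s).ne_zero]
    -- the kernel of `θ`
    have hker : RingHom.ker θ = P'.map (algebraMap A'.toSubring S) := by
      apply le_antisymm
      · intro x hx
        rw [← IsLocalization.mk'_sec (M := Q'.primeCompl) S x] at hx ⊢
        set a := (IsLocalization.sec Q'.primeCompl x).1
        set s := (IsLocalization.sec Q'.primeCompl x).2
        rw [RingHom.mem_ker, hθmk, div_eq_zero_iff, or_iff_left (hunits s).ne_zero] at hx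
        have ha : a ∈ P' := (residue_inclusion_eq_zero_iff O₁ A' hA'O₁ a).mp hx
        rw [IsLocalization.mk'_eq_mul_mk'_one]
        exact Ideal.mul_mem_right _ _ (Ideal.mem_map_of_mem _ ha)
      · rw [Ideal.map_le_iff_le_comap]
        intro a ha
        rw [Ideal.mem_comap, RingHom.mem_ker, IsLocalization.lift_eq]
        exact (residue_inclusion_eq_zero_iff O₁ A' hA'O₁ a).mpr ha
    -- `ψ` maps `A'` onto `B`
    let ψκ : A' →ₐ[k] κ :=
      { toFun := fun x => ⟨ψ x, by obtain ⟨b, -, hb⟩ := hψB x; rw [hb]; exact b.2⟩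
        map_one' := Subtype.ext (map_one ψ)
        map_mul' := fun x y => Subtype.ext (map_mul ψ x y)
        map_zero' := Subtype.ext (map_zero ψ)
        map_add' := fun x y => Subtype.ext (map_add ψ x y)
        commutes' := fun c => Subtype.ext rfl }
    have hBψ : ∀ b : κ, b ∈ B → ∃ x : A'.toSubring, ψ x = b := by
      have hle : B ≤ ψκ.range := by
        rw [← htB]
        refine Algebra.adjoin_le fun b hb => ?_
        have hgb : g b ∈ A' := by
          apply (le_sup_right : Algebra.adjoin k _ ≤ A')
          apply Algebra.subset_adjoin
          rw [Finset.coe_image]; exact ⟨b, hb, rfl⟩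
        refine ⟨⟨g b, hgb⟩, Subtype.ext ?_⟩
        exact hgres b
      intro b hb
      obtain ⟨x, hx⟩ := hle hb
      exact ⟨x, congrArg Subtype.val hx⟩
    -- the range of `θ` is `ι` of the local ring of `B` at the centre of `ν₂`
    haveI : IsFractionRing B₀.toSubring κ := hB₀frac
    haveI hBfrac : IsFractionRing B.toSubring κ := isFractionRing_subalgebra_of_le B₀ B hB₀B
    have hBO₂' : ∀ b : κ, b ∈ B → b ∈ O₂' := fun b hb => hB hb
    have hunitB : ∀ (b : κ) (hb : b ∈ B), O₂'.valuation b = 1 ↔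
        IsUnit (⟨ι b, hBO₂' b hb⟩ : O₂) := by
      intro b hb
      rw [← isUnit_comap_iff O₂ ι b (hBO₂' b hb), ValuationSubring.valuation_eq_one_iff]
    have hrangeθ : θ.range = ((Localization.subalgebra.ofField κ
        ((maximalIdeal O₂').comap (Subring.inclusion hB)).primeCompl
        (Ideal.primeCompl_le_nonZeroDivisors _))).toSubring.map ι := by
      ext y
      constructor
      · rintro ⟨x, rfl⟩
        rw [← IsLocalization.mk'_sec (M := Q'.primeCompl) S x]
        set a := (IsLocalization.sec Q'.primeCompl x).1
        set s := (IsLocalization.sec Q'.primeCompl x).2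
        obtain ⟨ba, hba, hψa⟩ := hψB a
        obtain ⟨bs, hbs, hψs⟩ := hψB s
        rw [hθmk, Subring.mem_map]
        refine ⟨ba * bs⁻¹, ?_, ?_⟩
        · change ba * bs⁻¹ ∈ (Localization.subalgebra.ofField κ
            ((maximalIdeal O₂').comap (Subring.inclusion hB)).primeCompl
            (Ideal.primeCompl_le_nonZeroDivisors _))
          rw [mem_centreLocalization_iff]
          refine ⟨ba, hba, bs, hbs, ?_, rfl⟩
          rw [hunitB bs hbs]
          have e : (⟨ι bs, hBO₂' bs hbs⟩ : O₂) = ⟨ψ s, hψO₂ s⟩ := Subtype.ext hψs.symm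
          rw [e]
          exact (hQ'iff s).mp s.2
        · change ((ba * bs⁻¹ : κ) : ResidueField O₁) = ψ a / ψ s
          push_cast
          rw [hψa, hψs, div_eq_mul_inv]
      · intro hy
        rw [Subring.mem_map] at hy
        obtain ⟨x, hx, rfl⟩ := hy
        change x ∈ (Localization.subalgebra.ofField κ
            ((maximalIdeal O₂').comap (Subring.inclusion hB)).primeCompl
            (Ideal.primeCompl_le_nonZeroDivisors _)) at hx
        rw [mem_centreLocalization_iff] at hx
        obtain ⟨b₁, hb₁, u, hu, hu1, rfl⟩ := hx
        obtain ⟨a₁, ha₁⟩ := hBψ b₁ hb₁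
        obtain ⟨s₁, hs₁⟩ := hBψ u hu
        have hs₁Q : s₁ ∉ Q' := by
          rw [hQ'iff s₁]
          have e : (⟨ψ s₁, hψO₂ s₁⟩ : O₂) = ⟨ι u, hBO₂' u hu⟩ := Subtype.ext hs₁
          rw [e]
          exact (hunitB u hu).mp hu1
        refine ⟨IsLocalization.mk' S a₁ (⟨s₁, hs₁Q⟩ : Q'.primeCompl), ?_⟩
        rw [hθmk]
        change ψ a₁ / ψ s₁ = ι (b₁ * u⁻¹)
        rw [map_mul, map_inv₀, ha₁, hs₁, div_eq_mul_inv]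
        rfl
    -- assemble the isomorphism `S / P' S ≅ B_{m_{ν₂} ∩ B}` and transfer regularity
    set X : Subalgebra B.toSubring κ := Localization.subalgebra.ofField κ
        ((maximalIdeal O₂').comap (Subring.inclusion hB)).primeCompl
        (Ideal.primeCompl_le_nonZeroDivisors _) with hXdef
    have hregL : IsRegularLocalRing X :=
      (isRegularLocalRing_iff_centreLocalization O₂' B hB).mp hregB
    let e₁ : S ⧸ P'.map (algebraMap A'.toSubring S) ≃+* θ.range :=
      (Ideal.quotEquivOfEq hker.symm).trans (RingHom.quotientKerEquivRange θ)
    let e₂ : θ.range ≃+* X.toSubring.map ι := RingEquiv.subringCongr hrangeθ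
    let e₃ : X.toSubring ≃+* X.toSubring.map ι :=
      Subring.equivMapOfInjective X.toSubring ι ι.injective
    haveI := hregL
    exact IsRegularLocalRing.of_ringEquiv (R := X) (e₃.trans (e₂.symm.trans e₁.symm))

end lifting

/-! ### Dimension bookkeeping -/

section height

variable {R : Type*} [CommRing R]

/-- Chains of primes below `P` and chains between `P` and `Q ⊇ P` concatenate: `height Q ≥ n + m`
whenever `n ≤ height P` and `m ≤ height (Q / P)`. [folklore] -/
theorem add_le_height_of_le (P Q : Ideal R) [P.IsPrime] [hQ : Q.IsPrime] (hPQ : P ≤ Q) (n m : ℕ)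
    (hn : (n : ℕ∞) ≤ P.height)
    (hm : (m : ℕ∞) ≤ (Q.map (Ideal.Quotient.mk P)).height) : ((n + m : ℕ) : ℕ∞) ≤ Q.height := by
  classical
  haveI hQ' : (Q.map (Ideal.Quotient.mk P)).IsPrime :=
    Ideal.map_isPrime_of_surjective Ideal.Quotient.mk_surjective (by rwa [Ideal.mk_ker])
  -- heights as order-theoretic heights in the prime spectra
  rw [PrimeSpectrum.height_eq_orderHeight ⟨P, inferInstance⟩] at hn
  rw [PrimeSpectrum.height_eq_orderHeight ⟨_, hQ'⟩] at hm
  rw [PrimeSpectrum.height_eq_orderHeight ⟨Q, hQ⟩]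
  obtain ⟨t₁, ht₁last, ht₁len⟩ := Order.exists_series_of_le_height _ hn
  obtain ⟨s, hslast, hslen⟩ := Order.exists_series_of_le_height _ hm
  -- transport `s` to `Spec R`
  let f : PrimeSpectrum (R ⧸ P) → PrimeSpectrum R :=
    fun q => ⟨q.asIdeal.comap (Ideal.Quotient.mk P), inferInstance⟩
  have hf : StrictMono f := by
    intro q q' hqq'
    change (f q).asIdeal < (f q').asIdeal
    simp only [f]
    rw [lt_iff_le_and_ne]
    refine ⟨Ideal.comap_mono hqq'.le, fun h => hqq'.ne ?_⟩
    ext1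
    exact Ideal.comap_injective_of_surjective _ Ideal.Quotient.mk_surjective h
  let s' : LTSeries (PrimeSpectrum R) := s.map f hf
  have hs'last : s'.last = ⟨Q, hQ⟩ := by
    change f s.last = _
    rw [hslast]
    ext1
    change (Q.map (Ideal.Quotient.mk P)).comap (Ideal.Quotient.mk P) = Q
    rw [Ideal.comap_map_of_surjective _ Ideal.Quotient.mk_surjective,
      ← RingHom.ker_eq_comap_bot, Ideal.mk_ker]
    exact sup_eq_left.mpr hPQ
  have hPhead : (⟨P, inferInstance⟩ : PrimeSpectrum R) ≤ s'.head := by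
    change P ≤ (s.head.asIdeal).comap (Ideal.Quotient.mk P)
    intro x hx
    rw [Ideal.mem_comap, Ideal.Quotient.eq_zero_iff_mem.mpr hx]
    exact Ideal.zero_mem _
  rcases hPhead.eq_or_lt with heq | hlt
  · let u := t₁.smash s' (ht₁last.trans heq)
    have hu : u.last = ⟨Q, hQ⟩ := by rw [RelSeries.last_smash]; exact hs'last
    have := Order.length_le_height_last (p := u)
    rw [hu] at this
    refine le_trans ?_ this
    change ((n + m : ℕ) : ℕ∞) ≤ ((t₁.length + s'.length : ℕ) : ℕ∞)
    have : s'.length = m := hslen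
    rw [ht₁len, this]
  · let u := t₁.append s' (ht₁last ▸ hlt)
    have hu : u.last = ⟨Q, hQ⟩ := by rw [RelSeries.last_append]; exact hs'last
    have := Order.length_le_height_last (p := u)
    rw [hu] at this
    refine le_trans ?_ this
    change ((n + m : ℕ) : ℕ∞) ≤ ((t₁.length + s'.length + 1 : ℕ) : ℕ∞)
    have : s'.length = m := hslen
    rw [ht₁len, this]
    exact_mod_cast Nat.le_succ _

/-- `R_Q / P R_Q` is the localisation of `R / P` at `Q / P`, so its dimension is the height of
`Q / P`. [folklore] -/
theorem ringKrullDim_localization_quotient (P Q : Ideal R) [P.IsPrime] [hQ : Q.IsPrime]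
    (hPQ : P ≤ Q) :
    ringKrullDim (Localization.AtPrime Q ⧸ P.map (algebraMap R (Localization.AtPrime Q))) =
      (Q.map (Ideal.Quotient.mk P)).height := by
  haveI hQ' : (Q.map (Ideal.Quotient.mk P)).IsPrime :=
    Ideal.map_isPrime_of_surjective Ideal.Quotient.mk_surjective (by rwa [Ideal.mk_ker])
  have hM : Algebra.algebraMapSubmonoid (R ⧸ P) Q.primeCompl =
      (Q.map (Ideal.Quotient.mk P)).primeCompl := by
    ext x
    simp only [Algebra.algebraMapSubmonoid, Submonoid.mem_map, Ideal.Quotient.algebraMap_eq]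
    constructor
    · rintro ⟨s, hs, rfl⟩ hs'
      apply hs
      have := Ideal.mem_comap.mpr hs'
      rwa [Ideal.comap_map_of_surjective _ Ideal.Quotient.mk_surjective,
        ← RingHom.ker_eq_comap_bot, Ideal.mk_ker, sup_eq_left.mpr hPQ] at this
    · intro hx
      obtain ⟨s, rfl⟩ := Ideal.Quotient.mk_surjective x
      exact ⟨s, fun hs => hx (Ideal.mem_map_of_mem _ hs), rfl⟩
  have inst : IsLocalization (Algebra.algebraMapSubmonoid (R ⧸ P) Q.primeCompl)
      (Localization.AtPrime Q ⧸ P.map (algebraMap R (Localization.AtPrime Q))) :=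
    inferInstance
  rw [hM] at inst
  exact IsLocalization.AtPrime.ringKrullDim_eq_height (Q.map (Ideal.Quotient.mk P)) _

end height

/-! ### The local ring at the centre modulo the centre of `ν₁`, inside `κ(O₁)` -/

section residueLift

variable {k : Type u} {K : Type v} [CommRing k] [Field K] [Algebra k K]
variable (O O₁ : ValuationSubring K) (hO : O ≤ O₁) (A : Subalgebra k K)
  (hA : A.toSubring ≤ O.toSubring)

/-- Elements outside the centre of `ν` have unit residue in `κ(O₁)`. [folklore] -/
theorem isUnit_residue_inclusion_of_notMem_centre
    (s : ((maximalIdeal O).comap (Subring.inclusion hA)).primeCompl) :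
    IsUnit (((residue O₁).comp (Subring.inclusion (hA.trans hO))) s) :=
  isUnit_residue_inclusion O₁ A _ s (fun h => s.2 (centre_mono O O₁ hO A hA h))

/-- **The residue map `A_{m_ν ∩ A} → κ(O₁)`, `a / s ↦ ā / s̄`, exists** (Novacoski–Spivakovsky
2014, proof of Lemma 2.15: the map `Φ` restricted to `R⁽¹⁾`). The lemmas below are stated
for any ring map `θ` out of the localisation extending the residue map of `A` (there is exactly
one, `IsLocalization.lift`). [folklore] -/
theorem exists_centreResidueLift :
    ∃ θ : Localization.AtPrime ((maximalIdeal O).comap (Subring.inclusion hA)) →+* ResidueField O₁,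
      ∀ a : A.toSubring, θ (algebraMap A.toSubring _ a)
          = ((residue O₁).comp (Subring.inclusion (hA.trans hO))) a :=
  ⟨IsLocalization.lift (M := ((maximalIdeal O).comap (Subring.inclusion hA)).primeCompl)
      (fun s => isUnit_residue_inclusion_of_notMem_centre O O₁ hO A hA s),
    fun a => IsLocalization.lift_eq _ a⟩

variable (θ : Localization.AtPrime ((maximalIdeal O).comap (Subring.inclusion hA))
    →+* ResidueField O₁)
  (hθ : ∀ a : A.toSubring, θ (algebraMap A.toSubring _ a)
      = ((residue O₁).comp (Subring.inclusion (hA.trans hO))) a)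

include hθ in
/-- A residue lift `θ` on fractions: `θ (a / s) = ā / s̄`. [folklore] -/
theorem centreResidueLift_mk' (a : A.toSubring)
    (s : ((maximalIdeal O).comap (Subring.inclusion hA)).primeCompl) :
    θ (IsLocalization.mk' _ a s) =
      ((residue O₁).comp (Subring.inclusion (hA.trans hO))) a /
          ((residue O₁).comp (Subring.inclusion (hA.trans hO))) s := by
  have hu := isUnit_residue_inclusion_of_notMem_centre O O₁ hO A hA s
  have h1 : θ (IsLocalization.mk' _ a s) * ((residue O₁).comp (Subring.inclusion (hA.trans hO))) s =
      ((residue O₁).comp (Subring.inclusion (hA.trans hO))) a := by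
    rw [← hθ (s : A.toSubring), ← map_mul, IsLocalization.mk'_spec, hθ]
  rw [eq_div_iff hu.ne_zero, h1]

include hθ in
/-- The kernel of a residue lift `A_{m_ν ∩ A} → κ(O₁)` is generated by the centre of `ν₁`.
[folklore] -/
theorem ker_centreResidueLift :
    RingHom.ker θ = ((maximalIdeal O₁).comap (Subring.inclusion (hA.trans hO))).map
        (algebraMap A.toSubring _) := by
  apply le_antisymm
  · intro x hx
    rw [← IsLocalization.mk'_sec (M := ((maximalIdeal O).comap (Subring.inclusion hA)).primeCompl)
        (Localization.AtPrime _) x]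
      at hx ⊢
    set a := (IsLocalization.sec ((maximalIdeal O).comap (Subring.inclusion hA)).primeCompl x).1
    set s := (IsLocalization.sec ((maximalIdeal O).comap (Subring.inclusion hA)).primeCompl x).2
    rw [RingHom.mem_ker, centreResidueLift_mk' O O₁ hO A hA θ hθ, div_eq_zero_iff,
      or_iff_left (isUnit_residue_inclusion_of_notMem_centre O O₁ hO A hA s).ne_zero] at hx
    have ha : a ∈ ((maximalIdeal O₁).comap (Subring.inclusion (hA.trans hO)))
        := (residue_inclusion_eq_zero_iff O₁ A _ a).mp hx
    rw [IsLocalization.mk'_eq_mul_mk'_one]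
    exact Ideal.mul_mem_right _ _ (Ideal.mem_map_of_mem _ ha)
  · rw [Ideal.map_le_iff_le_comap]
    intro a ha
    rw [Ideal.mem_comap, RingHom.mem_ker, hθ]
    exact (residue_inclusion_eq_zero_iff O₁ A _ a).mpr ha

include hθ in
/-- The range of a residue lift `A_{m_ν ∩ A} → κ(O₁)`: residues of fractions `a / s`,
`s ∉ m_ν`. [folklore] -/
theorem mem_range_centreResidueLift_iff (y : ResidueField O₁) :
    y ∈ θ.range ↔ ∃ a s : A.toSubring, s ∉ ((maximalIdeal O).comap (Subring.inclusion hA)) ∧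
      y = ((residue O₁).comp (Subring.inclusion (hA.trans hO))) a /
          ((residue O₁).comp (Subring.inclusion (hA.trans hO))) s := by
  constructor
  · rintro ⟨x, rfl⟩
    rw [← IsLocalization.mk'_sec (M := ((maximalIdeal O).comap (Subring.inclusion hA)).primeCompl)
        (Localization.AtPrime _) x]
    exact ⟨_, _, (IsLocalization.sec ((maximalIdeal O).comap (Subring.inclusion hA)).primeCompl
        x).2.2,
      centreResidueLift_mk' O O₁ hO A hA θ hθ _ _⟩
  · rintro ⟨a, s, hs, rfl⟩
    exact ⟨IsLocalization.mk' _ a (⟨s, hs⟩ :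
        ((maximalIdeal O).comap (Subring.inclusion hA)).primeCompl),
      centreResidueLift_mk' O O₁ hO A hA θ hθ _ _⟩

include hθ in
/-- `A_{m_ν ∩ A} / (m_{ν₁} ∩ A) A_{m_ν ∩ A}` is realised inside `κ(O₁)` as the range of a
residue lift. [folklore] -/
theorem nonempty_quotCentre_ringEquiv_range :
    Nonempty ((Localization.AtPrime ((maximalIdeal O).comap (Subring.inclusion hA)) ⧸
      ((maximalIdeal O₁).comap (Subring.inclusion (hA.trans hO))).map
        (algebraMap A.toSubring
            (Localization.AtPrime ((maximalIdeal O).comap (Subring.inclusion hA))))) ≃+* θ.range) :=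
  ⟨(Ideal.quotEquivOfEq (ker_centreResidueLift O O₁ hO A hA θ hθ).symm).trans
    (RingHom.quotientKerEquivRange _)⟩

/-- `s ∈ A` lies outside the centre of `ν` iff its residue is a unit of `O / m_{O₁}`.
[folklore] -/
theorem notMem_centre_iff_isUnit_residue (s : A.toSubring) :
    s ∉ ((maximalIdeal O).comap (Subring.inclusion hA))
        ↔ IsUnit (⟨((residue O₁).comp (Subring.inclusion (hA.trans hO))) s,
      (residue_mem_residueValuationSubring_iff O O₁ hO _).mpr (hA s.2)⟩ :
        residueValuationSubring O O₁ hO) := by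
  rw [mem_centre_iff_lt_one, valuation_lt_one_iff_residue O O₁ hO (s : K) (hA s.2)]
  exact not_valuation_lt_one_iff _ ⟨_, _⟩

include hθ in
/-- **Models with the same residues have the same `R / p`** (the mechanism of Lemma 2.19 (i)):
if every element of the larger model `A' ⊇ A` has the residue of an element of `A`, the two
realisations inside `κ(O₁)` coincide. [folklore] -/
theorem range_centreResidueLift_eq (A' : Subalgebra k K) (hA' : A'.toSubring ≤ O.toSubring)
    (hAA' : A ≤ A')
    (θ' : Localization.AtPrime ((maximalIdeal O).comap (Subring.inclusion hA')) →+* ResidueField O₁)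
    (hθ' : ∀ a : A'.toSubring, θ' (algebraMap A'.toSubring _ a) =
      ((residue O₁).comp (Subring.inclusion (hA'.trans hO))) a)
    (h : ∀ x : A'.toSubring, ∃ a : A.toSubring,
      ((residue O₁).comp (Subring.inclusion (hA'.trans hO))) x
          = ((residue O₁).comp (Subring.inclusion (hA.trans hO))) a) :
    θ'.range = θ.range := by
  have hincl : ∀ a : A.toSubring, ((residue O₁).comp (Subring.inclusion (hA'.trans hO)))
      ⟨a, hAA' a.2⟩ =
      ((residue O₁).comp (Subring.inclusion (hA.trans hO))) a := fun a => rfl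
  ext y
  rw [mem_range_centreResidueLift_iff O O₁ hO A' hA' θ' hθ',
    mem_range_centreResidueLift_iff O O₁ hO A hA θ hθ]
  constructor
  · rintro ⟨a', s', hs', rfl⟩
    obtain ⟨a, ha⟩ := h a'
    obtain ⟨s, hs⟩ := h s'
    refine ⟨a, s, ?_, by rw [ha, hs]⟩
    rw [notMem_centre_iff_isUnit_residue O O₁ hO A' hA'] at hs'
    rw [notMem_centre_iff_isUnit_residue O O₁ hO A hA]
    have e : (⟨((residue O₁).comp (Subring.inclusion (hA.trans hO))) s,
        (residue_mem_residueValuationSubring_iff O O₁ hO _).mpr (hA s.2)⟩ :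
          residueValuationSubring O O₁ hO) = ⟨((residue O₁).comp (Subring.inclusion (hA'.trans hO)))
              s',
        (residue_mem_residueValuationSubring_iff O O₁ hO _).mpr (hA' s'.2)⟩ :=
      Subtype.ext hs.symm
    rw [e]
    exact hs'
  · rintro ⟨a, s, hs, rfl⟩
    refine ⟨⟨a, hAA' a.2⟩, ⟨s, hAA' s.2⟩, ?_, by rw [hincl, hincl]⟩
    rw [notMem_centre_iff_isUnit_residue O O₁ hO A hA] at hs
    rw [notMem_centre_iff_isUnit_residue O O₁ hO A' hA']
    exact hs

end residueLift

/-! ### The dimension count of §3.1 -/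

section count

variable {R : Type*} [CommRing R] [IsNoetherianRing R] (P Q : Ideal R) [P.IsPrime] [Q.IsPrime]

/-- **The dimension count** (Novacoski–Spivakovsky 2014, §3.1, p. 14: "since
`y_1, …, y_r, x_1, …, x_t` generate `m` we have `r + t ≥ dim R`. Also, since `r = dim R_p = ht p`
and `t = dim R/p = ht(m/p)` we have `dim R = ht m ≥ ht p + ht(m/p) = r + t ≥ dim R` […] hence
`(R, m)` is regular."). For primes `P ⊆ Q` of a Noetherian ring: if `P` is generated by at
most `dim R_P` elements and `R_Q / P R_Q` is regular, then `R_Q` is regular.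
[cite: NovacoskiSpivakovsky2014, §3.1] -/
theorem isRegularLocalRing_localization_of_quotient (hPQ : P ≤ Q) (Y : Finset R)
    (hY : P = Ideal.span (Y : Set R))
    (hYcard : (Y.card : WithBot ℕ∞) ≤ ringKrullDim (Localization.AtPrime P))
    (hreg : IsRegularLocalRing
      (Localization.AtPrime Q ⧸ P.map (algebraMap R (Localization.AtPrime Q)))) :
    IsRegularLocalRing (Localization.AtPrime Q) := by
  classical
  haveI := hreg
  obtain ⟨G, hGcard, hGspan⟩ :=
    Submodule.FG.exists_span_finset_card_eq_spanFinrank (IsNoetherian.noetherian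
      (maximalIdeal (Localization.AtPrime Q ⧸ P.map (algebraMap R (Localization.AtPrime Q)))))
  let π : Localization.AtPrime Q →+*
      Localization.AtPrime Q ⧸ P.map (algebraMap R (Localization.AtPrime Q)) :=
    Ideal.Quotient.mk _
  have hπ : Function.Surjective π := Ideal.Quotient.mk_surjective
  have hπ' := hπ
  choose lift hlift using hπ'
  have hmaxS : maximalIdeal (Localization.AtPrime Q) =
      Q.map (algebraMap R (Localization.AtPrime Q)) :=
    Localization.AtPrime.map_eq_maximalIdeal.symm
  have hker : RingHom.ker π = P.map (algebraMap R (Localization.AtPrime Q)) := Ideal.mk_ker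
  have hkerle : RingHom.ker π ≤ maximalIdeal (Localization.AtPrime Q) := by
    rw [hker, hmaxS]; exact Ideal.map_mono hPQ
  -- `m_{R_Q}` maps onto the maximal ideal of `R_Q / P`
  have hmapmax : (maximalIdeal (Localization.AtPrime Q)).map π = maximalIdeal
      (Localization.AtPrime Q ⧸ P.map (algebraMap R (Localization.AtPrime Q))) := by
    rcases Ideal.map_eq_top_or_isMaximal_of_surjective π hπ
      (H := IsLocalRing.maximalIdeal.isMaximal (Localization.AtPrime Q)) with h | h
    · exfalso
      have := congrArg (Ideal.comap π) h
      rw [Ideal.comap_map_of_surjective π hπ, Ideal.comap_top, ← RingHom.ker_eq_comap_bot,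
        sup_eq_left.mpr hkerle] at this
      exact (IsLocalRing.maximalIdeal.isMaximal (Localization.AtPrime Q)).ne_top this
    · exact IsLocalRing.eq_maximalIdeal h
  -- `m_{R_Q}` is generated by `Y` and lifts of `dim (R_Q / P)` generators
  let gens : Finset (Localization.AtPrime Q) :=
    Y.image (algebraMap R (Localization.AtPrime Q)) ∪ G.image lift
  have hgens : maximalIdeal (Localization.AtPrime Q) =
      Ideal.span (gens : Set (Localization.AtPrime Q)) := by
    apply le_antisymm
    · intro x hx
      have h1 : π x ∈ (Ideal.span ((G.image lift : Finset (Localization.AtPrime Q)) :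
          Set (Localization.AtPrime Q))).map π := by
        rw [Ideal.map_span, Finset.coe_image, ← Set.image_comp]
        have hcomp : (π ∘ lift) '' (G : Set (Localization.AtPrime Q ⧸
            P.map (algebraMap R (Localization.AtPrime Q)))) = G := by
          have : (π : Localization.AtPrime Q →
              Localization.AtPrime Q ⧸ P.map (algebraMap R (Localization.AtPrime Q))) ∘ lift =
                id := funext hlift
          rw [this, Set.image_id]
        rw [hcomp, show Ideal.span (G : Set (Localization.AtPrime Q ⧸
            P.map (algebraMap R (Localization.AtPrime Q)))) = maximalIdeal _ from hGspan,
          ← hmapmax]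
        exact Ideal.mem_map_of_mem _ hx
      have hPmap : P.map (algebraMap R (Localization.AtPrime Q)) =
          Ideal.span (algebraMap R (Localization.AtPrime Q) '' (Y : Set R)) := by
        rw [hY, Ideal.map_span]
      rw [← Ideal.mem_comap, Ideal.comap_map_of_surjective π hπ, ← RingHom.ker_eq_comap_bot]
        at h1
      have h2 : Ideal.span ((G.image lift : Finset (Localization.AtPrime Q)) :
          Set (Localization.AtPrime Q)) ⊔ RingHom.ker π ≤
            Ideal.span (gens : Set (Localization.AtPrime Q)) := by
        apply sup_le
        · apply Ideal.span_mono
          intro z hz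
          simp only [gens, Finset.coe_union]
          exact Or.inr hz
        · rw [hker, hPmap]
          apply Ideal.span_mono
          intro z hz
          simp only [gens, Finset.coe_union, Finset.coe_image]
          exact Or.inl hz
      exact h2 h1
    · rw [Ideal.span_le]
      intro z hz
      simp only [gens, Finset.coe_union, Finset.coe_image, Set.mem_union, Set.mem_image,
        Finset.mem_coe] at hz
      rcases hz with ⟨y, hy, rfl⟩ | ⟨g, hg, rfl⟩
      · rw [SetLike.mem_coe,
          IsLocalization.AtPrime.to_map_mem_maximal_iff (Localization.AtPrime Q) Q]
        apply hPQ
        rw [hY]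
        exact Ideal.subset_span hy
      · rw [SetLike.mem_coe, mem_maximalIdeal, mem_nonunits_iff]
        intro hu
        have hg' : g ∈ maximalIdeal _ := hGspan ▸ Submodule.subset_span hg
        rw [mem_maximalIdeal, mem_nonunits_iff] at hg'
        apply hg'
        rw [← hlift g]
        exact hu.map π
  have hspan : (maximalIdeal (Localization.AtPrime Q)).spanFinrank ≤ Y.card + G.card := by
    rw [hgens]
    refine (Submodule.spanFinrank_span_le_ncard_of_finite (Finset.finite_toSet gens)).trans ?_
    rw [Set.ncard_coe_finset]
    exact (Finset.card_union_le _ _).trans (add_le_add Finset.card_image_le Finset.card_image_le)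
  -- heights: `#Y ≤ ht P`, `dim (R_Q / P) = ht (Q / P)`, `ht P + ht (Q / P) ≤ ht Q = dim R_Q`
  have hr : ((Y.card : ℕ) : ℕ∞) ≤ P.height := by
    rw [IsLocalization.AtPrime.ringKrullDim_eq_height P (Localization.AtPrime P)] at hYcard
    exact_mod_cast hYcard
  have ht : ((G.card : ℕ) : ℕ∞) ≤ (Q.map (Ideal.Quotient.mk P)).height := by
    have h1 := hreg.spanFinrank_maximalIdeal
    rw [ringKrullDim_localization_quotient P Q hPQ] at h1
    have h2 : ((maximalIdeal (Localization.AtPrime Q ⧸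
        P.map (algebraMap R (Localization.AtPrime Q)))).spanFinrank : ℕ∞) =
          (Q.map (Ideal.Quotient.mk P)).height := by
      exact_mod_cast h1
    rw [← h2, hGcard]
  have hsum := add_le_height_of_le P Q hPQ Y.card G.card hr ht
  have hdimS : ringKrullDim (Localization.AtPrime Q) = Q.height :=
    IsLocalization.AtPrime.ringKrullDim_eq_height Q (Localization.AtPrime Q)
  apply IsRegularLocalRing.of_spanFinrank_maximalIdeal_le
  rw [hdimS]
  have : ((maximalIdeal (Localization.AtPrime Q)).spanFinrank : ℕ∞) ≤ Q.height :=
    le_trans (by exact_mod_cast hspan) hsum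
  exact_mod_cast this

end count

/-! ### §3.1, final step -/

section final

variable {k : Type u} {K : Type v} [CommRing k] [Field K] [Algebra k K]

/-- **Novacoski–Spivakovsky 2014, §3.1, final step of the proof of Thm. 1.1** (pp. 14–15, with
Lemma 2.18 — numerators of a regular system of parameters of `R_p` — and Lemma 2.19 — the
blowing up along `(a, y_1, …, y_r)` keeps `R/p` and `R_p`): "Replacing `R` by `R⁽ᵐ⁾`, we may
assume that both `R_p` and `R/p` are regular. […] We proceed as before with `a_k` for all
`k = 2, …, s` until we reach a local ring `R⁽ˢ⁾` […]. Therefore, `R⁽ˢ⁾` is regular." I.e. for a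
Noetherian local domain `(R, m)` dominated by `ν = ν₁ ∘ ν₂` with `p` the centre of `ν₁`: if `R_p`
and `R/p` are regular, a finite sequence of local blowing ups with respect to `ν` ends in a
regular local ring. PROVED here for affine models `A ⊆ O` of `K` over a Noetherian base ring `k`
(`O ≤ O₁`); see the module docstring for the affine translation and the
(inessential) shortcut `h_k = 0`, one blowing up along `(∏ a_k, y)`.
[cite: NovacoskiSpivakovsky2014, §3.1 (proof of Thm. 1.1)] -/
theorem novacoskiSpivakovsky2014_step [IsNoetherianRing k] (O O₁ : ValuationSubring K) (hO : O ≤ O₁)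
    (A : Subalgebra k K) (hA : A.toSubring ≤ O.toSubring) (hAfg : A.FG)
    (hfrac : IsFractionRing A K)
    (hregP : IsRegularLocalRing
      (Localization.AtPrime ((maximalIdeal O₁).comap (Subring.inclusion (hA.trans hO)))))
    (hregQ : IsRegularLocalRing
      (Localization.AtPrime ((maximalIdeal O).comap (Subring.inclusion hA)) ⧸
        ((maximalIdeal O₁).comap (Subring.inclusion (hA.trans hO))).map
          (algebraMap A.toSubring
            (Localization.AtPrime ((maximalIdeal O).comap (Subring.inclusion hA)))))) :
    ∃ (A' : Subalgebra k K) (hA' : A'.toSubring ≤ O.toSubring), A ≤ A' ∧ A'.FG ∧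
      IsRegularLocalRing
        (Localization.AtPrime ((maximalIdeal O).comap (Subring.inclusion hA'))) := by
  classical
  haveI : IsFractionRing A.toSubring K := hfrac
  haveI hnoeth : IsNoetherianRing A.toSubring := isNoetherianRing_of_fg hAfg
  have hAO₁ : A.toSubring ≤ O₁.toSubring := hA.trans hO
  set P := ((maximalIdeal O₁).comap (Subring.inclusion hAO₁)) with hPdef
  set Q := ((maximalIdeal O).comap (Subring.inclusion hA)) with hQdef
  have hPQ : P ≤ Q := centre_mono O O₁ hO A hA
  -- Step 1 (Lemma 2.18): `Y ⊆ P` finite, generating `P A_P`, with `#Y ≤ dim A_P`.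
  let AP := Localization.AtPrime P
  haveI : IsRegularLocalRing AP := hregP
  obtain ⟨sP, hsPcard, hsPspan⟩ :=
    Submodule.FG.exists_span_finset_card_eq_spanFinrank
      (IsNoetherian.noetherian (maximalIdeal AP))
  have hnum : ∀ g : AP, ∃ y : A.toSubring, ∃ s : P.primeCompl,
      g * algebraMap A.toSubring AP s = algebraMap A.toSubring AP y := by
    intro g
    obtain ⟨⟨y, s⟩, h⟩ := IsLocalization.surj P.primeCompl g
    exact ⟨y, s, h⟩
  choose num den hnumden using hnum
  let Y : Finset A.toSubring := sP.image num
  have hYP : ∀ y ∈ Y, y ∈ P := by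
    intro y hy
    obtain ⟨g, hg, rfl⟩ := Finset.mem_image.mp hy
    rw [← IsLocalization.AtPrime.to_map_mem_maximal_iff AP P, ← hnumden g]
    apply Ideal.mul_mem_right
    rw [← hsPspan]
    exact Submodule.subset_span hg
  set IY : Ideal A.toSubring := Ideal.span (Y : Set A.toSubring) with hIYdef
  have hIYmap : IY.map (algebraMap A.toSubring AP) = maximalIdeal AP := by
    apply le_antisymm
    · rw [Ideal.map_le_iff_le_comap, hIYdef, Ideal.span_le]
      intro y hy
      rw [SetLike.mem_coe, Ideal.mem_comap, IsLocalization.AtPrime.to_map_mem_maximal_iff AP P]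
      exact hYP y hy
    · rw [← hsPspan, Ideal.span_le]
      intro g hg
      have hu : IsUnit (algebraMap A.toSubring AP (den g)) :=
        IsLocalization.map_units AP (den g)
      rw [SetLike.mem_coe, ← Ideal.unit_mul_mem_iff_mem _ hu, mul_comm, hnumden g]
      apply Ideal.mem_map_of_mem
      apply Ideal.subset_span
      exact Finset.mem_image_of_mem num hg
  have hYcard : Y.card ≤ (maximalIdeal AP).spanFinrank :=
    hsPcard ▸ Finset.card_image_le
  -- Step 2: `a ∉ P` with `a P ⊆ (Y)`.
  have hclear : ∀ z : A.toSubring, z ∈ P → ∃ m ∈ P.primeCompl, m * z ∈ IY := by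
    intro z hz
    rw [← IsLocalization.algebraMap_mem_map_algebraMap_iff P.primeCompl AP, hIYmap,
      IsLocalization.AtPrime.to_map_mem_maximal_iff AP P]
    exact hz
  choose m hm hmz using hclear
  obtain ⟨sgen, hsgen⟩ := IsNoetherian.noetherian (R := A.toSubring) (M := A.toSubring) P
  let m' : A.toSubring → A.toSubring := fun z => if hz : z ∈ P then m z hz else 1
  let a : A.toSubring := ∏ z ∈ sgen, m' z
  have hsgenP : ∀ z ∈ sgen, z ∈ P := fun z hz => hsgen ▸ Ideal.subset_span hz
  have haP : a ∈ P.primeCompl := by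
    apply prod_mem
    intro z hz
    simp only [m', dif_pos (hsgenP z hz)]
    exact hm z _
  have hamul : ∀ z ∈ P, a * z ∈ IY := by
    have h : Ideal.span {a} * P ≤ IY := by
      rw [← hsgen, Ideal.span_mul_span, Ideal.span_le]
      rintro _ ⟨x, hx, z, hz, rfl⟩
      rw [Set.mem_singleton_iff.mp hx]
      change (∏ z ∈ sgen, m' z) * z ∈ IY
      rw [← Finset.mul_prod_erase sgen m' hz, mul_comm (m' z), mul_assoc]
      apply Ideal.mul_mem_left
      simp only [m', dif_pos (hsgenP z hz)]
      exact hmz z _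
    exact fun z hz => Ideal.span_singleton_mul_le_iff.mp h z hz
  have ha1 : O₁.valuation (a : K) = 1 := (mem_primeCompl_centre_iff O₁ A hAO₁ a).mp haP
  have ha0 : (a : K) ≠ 0 := by intro h; rw [h, map_zero] at ha1; exact zero_ne_one ha1
  -- Step 3: the blowing up `A' = A[y/a : y ∈ Y]` along `(a, Y)`.
  let w₀ : A.toSubring → K := fun y => (y : K) / (a : K)
  have hw₀val : ∀ y ∈ Y, O₁.valuation (w₀ y) < 1 := by
    intro y hy
    have := (mem_centre_iff_lt_one O₁ A hAO₁ y).mp (hYP y hy)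
    simp only [w₀, map_div₀, ha1, div_one]
    exact this
  have hw₀O₁ : ∀ y ∈ Y, w₀ y ∈ O₁ := fun y hy =>
    (O₁.valuation_le_one_iff _).mp (hw₀val y hy).le
  have hw₀O : ∀ y ∈ Y, w₀ y ∈ O := by
    intro y hy
    apply mem_of_mem_maximalIdeal_of_le O O₁ hO ⟨w₀ y, hw₀O₁ y hy⟩
    rw [ValuationSubring.valuation_lt_one_iff]
    exact hw₀val y hy
  let W : Finset K := Y.image w₀
  let A' : Subalgebra k K := A ⊔ Algebra.adjoin k (W : Set K)
  have hk : ∀ c : k, algebraMap k K c ∈ O := fun c => hA (A.algebraMap_mem c)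
  have hA'O : A'.toSubring ≤ O.toSubring := by
    have : A' ≤ ({ O.toSubring with algebraMap_mem' := hk } : Subalgebra k K) := by
      refine sup_le (fun x hx => hA hx) (Algebra.adjoin_le ?_)
      intro x hx
      rw [Finset.coe_image] at hx
      obtain ⟨y, hy, rfl⟩ := hx
      exact hw₀O y hy
    exact fun x hx => this hx
  have hAA' : A ≤ A' := le_sup_left
  have hA'fg : A'.FG := hAfg.sup ⟨_, rfl⟩
  have hA'O₁ : A'.toSubring ≤ O₁.toSubring := hA'O.trans hO
  haveI hfrac' : IsFractionRing A'.toSubring K := isFractionRing_subalgebra_of_le A A' hAA'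
  haveI hnoeth' : IsNoetherianRing A'.toSubring := isNoetherianRing_of_fg hA'fg
  have hwA' : ∀ y ∈ Y, w₀ y ∈ A' := by
    intro y hy
    apply (le_sup_right : Algebra.adjoin k (W : Set K) ≤ A')
    apply Algebra.subset_adjoin
    rw [Finset.coe_image]
    exact ⟨y, hy, rfl⟩
  set P' := ((maximalIdeal O₁).comap (Subring.inclusion hA'O₁)) with hP'def
  set Q' := ((maximalIdeal O).comap (Subring.inclusion hA'O)) with hQ'def
  have hP'Q' : P' ≤ Q' := centre_mono O O₁ hO A' hA'O
  let incl : A.toSubring →+* A'.toSubring := Subring.inclusion fun x hx => hAA' hx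
  have hinclP : ∀ c : A.toSubring, incl c ∈ P' ↔ c ∈ P := fun c => Iff.rfl
  have hinclQ : ∀ c : A.toSubring, incl c ∈ Q' ↔ c ∈ Q := fun c => Iff.rfl
  -- the ideal `J' = (y/a : y ∈ Y) A'`
  let w : Y → A'.toSubring := fun y => ⟨w₀ y, hwA' y y.2⟩
  set J' : Ideal A'.toSubring := Ideal.span (Set.range w) with hJ'def
  have hJ'P' : J' ≤ P' := by
    rw [hJ'def, Ideal.span_le]
    rintro _ ⟨y, rfl⟩
    rw [SetLike.mem_coe, mem_centre_iff_lt_one]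
    exact hw₀val y y.2
  -- `P ⊆ J'`
  have hincl_y : ∀ y : Y, incl y = incl a * w y := by
    intro y
    apply Subtype.ext
    change ((y : A.toSubring) : K) = (a : K) * (((y : A.toSubring) : K) / (a : K))
    field_simp
  have hPJ' : ∀ z ∈ P, incl z ∈ J' := by
    intro z hz
    have h1 : incl (a * z) ∈ Ideal.span {incl a} * J' := by
      have : IY.map incl ≤ Ideal.span {incl a} * J' := by
        rw [hIYdef, Ideal.map_span, Ideal.span_le]
        rintro _ ⟨y, hy, rfl⟩
        rw [SetLike.mem_coe, show incl y = incl a * w ⟨y, hy⟩ from hincl_y ⟨y, hy⟩]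
        exact Ideal.mul_mem_mul (Ideal.mem_span_singleton_self _)
          (Ideal.subset_span ⟨⟨y, hy⟩, rfl⟩)
      exact this (Ideal.mem_map_of_mem _ (hamul z hz))
    rw [Ideal.mem_span_singleton_mul] at h1
    obtain ⟨b, hb, hab⟩ := h1
    rw [map_mul] at hab
    have ha0' : incl a ≠ 0 := by
      intro h; apply ha0
      exact congrArg Subtype.val h
    rw [← mul_left_cancel₀ ha0' hab]
    exact hb
  -- `A' = A + J'`
  have hdecomp : ∀ x : A'.toSubring, ∃ c : A.toSubring, x - incl c ∈ J' := by
    let T : Subalgebra k K :=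
      { carrier := {x | ∃ X : A'.toSubring, (X : K) = x ∧ ∃ c : A.toSubring, X - incl c ∈ J'}
        mul_mem' := by
          rintro _ _ ⟨X, rfl, c, hc⟩ ⟨X', rfl, c', hc'⟩
          refine ⟨X * X', rfl, c * c', ?_⟩
          have : X * X' - incl (c * c') = (X - incl c) * X' + incl c * (X' - incl c') := by
            rw [map_mul]; ring
          rw [this]
          exact J'.add_mem (J'.mul_mem_right _ hc) (J'.mul_mem_left _ hc')
        one_mem' := ⟨1, rfl, 1, by rw [map_one, sub_self]; exact J'.zero_mem⟩
        add_mem' := by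
          rintro _ _ ⟨X, rfl, c, hc⟩ ⟨X', rfl, c', hc'⟩
          refine ⟨X + X', rfl, c + c', ?_⟩
          have : X + X' - incl (c + c') = (X - incl c) + (X' - incl c') := by
            rw [map_add]; ring
          rw [this]
          exact J'.add_mem hc hc'
        zero_mem' := ⟨0, rfl, 0, by rw [map_zero, sub_self]; exact J'.zero_mem⟩
        algebraMap_mem' := fun c₀ => by
          refine ⟨⟨algebraMap k K c₀, A'.algebraMap_mem c₀⟩, rfl,
            ⟨algebraMap k K c₀, A.algebraMap_mem c₀⟩, ?_⟩
          have e : incl ⟨algebraMap k K c₀, A.algebraMap_mem c₀⟩ =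
              (⟨algebraMap k K c₀, A'.algebraMap_mem c₀⟩ : A'.toSubring) := Subtype.ext rfl
          rw [e, sub_self]; exact J'.zero_mem }
    have hA'T : A' ≤ T := by
      refine sup_le (fun x hx => ?_) (Algebra.adjoin_le fun x hx => ?_)
      · refine ⟨⟨x, hAA' hx⟩, rfl, ⟨x, hx⟩, ?_⟩
        have e : incl ⟨x, hx⟩ = (⟨x, hAA' hx⟩ : A'.toSubring) := Subtype.ext rfl
        rw [e, sub_self]; exact J'.zero_mem
      · rw [Finset.coe_image] at hx
        obtain ⟨y, hy, rfl⟩ := hx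
        exact ⟨w ⟨y, hy⟩, rfl, 0, by
          rw [map_zero, sub_zero]; exact Ideal.subset_span ⟨⟨y, hy⟩, rfl⟩⟩
    intro x
    obtain ⟨X, hX, c, hc⟩ := hA'T x.2
    have : X = x := Subtype.ext hX
    exact ⟨c, this ▸ hc⟩
  -- residues of `A'` are residues of `A` (Lemma 2.19 (i))
  have hres : ∀ x : A'.toSubring, ∃ c : A.toSubring,
      ((residue O₁).comp (Subring.inclusion hA'O₁)) x
          = ((residue O₁).comp (Subring.inclusion hAO₁)) c := by
    intro x
    obtain ⟨c, hc⟩ := hdecomp x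
    refine ⟨c, ?_⟩
    have h0 : ((residue O₁).comp (Subring.inclusion hA'O₁)) (x - incl c) = 0 :=
      (residue_inclusion_eq_zero_iff O₁ A' hA'O₁ _).mpr (hJ'P' hc)
    rw [map_sub, sub_eq_zero] at h0
    exact h0
  -- `P' = J'`
  have hP'J' : P' = J' := by
    refine le_antisymm (fun z hz => ?_) hJ'P'
    obtain ⟨c, hc⟩ := hdecomp z
    have hc' : incl c ∈ P' := by
      have := P'.sub_mem hz (hJ'P' hc)
      rwa [sub_sub_cancel] at this
    have := J'.add_mem hc (hPJ' c ((hinclP c).mp hc'))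
    rwa [sub_add_cancel] at this
  -- `A'_{P'} = A_P` inside `K` (Lemma 2.19 (ii))
  have heq1 : ((Localization.subalgebra.ofField K
      ((maximalIdeal O₁).comap (Subring.inclusion hA'O₁)).primeCompl
      (Ideal.primeCompl_le_nonZeroDivisors _)) : Set K)
      = (Localization.subalgebra.ofField K
      ((maximalIdeal O₁).comap (Subring.inclusion hAO₁)).primeCompl
      (Ideal.primeCompl_le_nonZeroDivisors _)) := by
    have h1 : (A' : Set K) ⊆ (Localization.subalgebra.ofField K
        ((maximalIdeal O₁).comap (Subring.inclusion hAO₁)).primeCompl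
        (Ideal.primeCompl_le_nonZeroDivisors _)) := by
      refine fun x hx => (sup_le (fun x hx => le_centreLocalization O₁ A hAO₁ hx)
        (Algebra.adjoin_le ?_) : A' ≤ { ((Localization.subalgebra.ofField K
            ((maximalIdeal O₁).comap (Subring.inclusion hAO₁)).primeCompl
            (Ideal.primeCompl_le_nonZeroDivisors _))).toSubring with
          algebraMap_mem' := fun c =>
            le_centreLocalization O₁ A hAO₁ (A.algebraMap_mem c) }) hx
      intro x hx
      rw [Finset.coe_image] at hx
      obtain ⟨y, hy, rfl⟩ := hx
      change w₀ y ∈ (Localization.subalgebra.ofField K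
          ((maximalIdeal O₁).comap (Subring.inclusion hAO₁)).primeCompl
          (Ideal.primeCompl_le_nonZeroDivisors _))
      rw [mem_centreLocalization_iff]
      exact ⟨y, y.2, a, a.2, ha1, div_eq_mul_inv _ _⟩
    have h2 : (A : Set K) ⊆ (Localization.subalgebra.ofField K
        ((maximalIdeal O₁).comap (Subring.inclusion hA'O₁)).primeCompl
        (Ideal.primeCompl_le_nonZeroDivisors _)) :=
      fun x hx => le_centreLocalization O₁ A' hA'O₁ (hAA' hx)
    exact le_antisymm (centreLocalization_le O₁ A' A hA'O₁ hAO₁ h1)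
      (centreLocalization_le O₁ A A' hAO₁ hA'O₁ h2)
  have hdimP : ringKrullDim (Localization.AtPrime P') = ringKrullDim AP := by
    let e₁ := (IsLocalization.algEquiv P'.primeCompl (Localization.AtPrime P')
      ((Localization.subalgebra.ofField K
          ((maximalIdeal O₁).comap (Subring.inclusion hA'O₁)).primeCompl
          (Ideal.primeCompl_le_nonZeroDivisors _)))).toRingEquiv
    have heq' : ((Localization.subalgebra.ofField K
        ((maximalIdeal O₁).comap (Subring.inclusion hA'O₁)).primeCompl
        (Ideal.primeCompl_le_nonZeroDivisors _))).toSubring =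
        ((Localization.subalgebra.ofField K
            ((maximalIdeal O₁).comap (Subring.inclusion hAO₁)).primeCompl
            (Ideal.primeCompl_le_nonZeroDivisors _))).toSubring := SetLike.coe_injective heq1
    let e₂ : ((Localization.subalgebra.ofField K
        ((maximalIdeal O₁).comap (Subring.inclusion hA'O₁)).primeCompl
        (Ideal.primeCompl_le_nonZeroDivisors _)))
        ≃+* ((Localization.subalgebra.ofField K
        ((maximalIdeal O₁).comap (Subring.inclusion hAO₁)).primeCompl
        (Ideal.primeCompl_le_nonZeroDivisors _))) :=
      RingEquiv.subringCongr heq'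
    let e₃ := (IsLocalization.algEquiv P.primeCompl AP
        ((Localization.subalgebra.ofField K
        ((maximalIdeal O₁).comap (Subring.inclusion hAO₁)).primeCompl
        (Ideal.primeCompl_le_nonZeroDivisors _)))).toRingEquiv
    exact ringKrullDim_eq_of_ringEquiv (e₁.trans (e₂.trans e₃.symm))
  -- `A'_{Q'} / P' ≅ A_Q / P` is regular
  have hregSQ : IsRegularLocalRing (Localization.AtPrime Q' ⧸
      P'.map (algebraMap A'.toSubring (Localization.AtPrime Q'))) := by
    obtain ⟨θ, hθ⟩ := exists_centreResidueLift O O₁ hO A hA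
    obtain ⟨θ', hθ'⟩ := exists_centreResidueLift O O₁ hO A' hA'O
    have hrange := range_centreResidueLift_eq O O₁ hO A hA θ hθ A' hA'O hAA' θ' hθ' hres
    obtain ⟨e₁⟩ := nonempty_quotCentre_ringEquiv_range O O₁ hO A hA θ hθ
    obtain ⟨e₂⟩ := nonempty_quotCentre_ringEquiv_range O O₁ hO A' hA'O θ' hθ'
    have e : (Localization.AtPrime Q ⧸ P.map (algebraMap A.toSubring (Localization.AtPrime Q))) ≃+*
        (Localization.AtPrime Q' ⧸ P'.map (algebraMap A'.toSubring (Localization.AtPrime Q'))) :=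
      e₁.trans ((RingEquiv.subringCongr hrange.symm).trans e₂.symm)
    haveI := hregQ
    exact IsRegularLocalRing.of_ringEquiv
      (R := Localization.AtPrime Q ⧸ P.map (algebraMap A.toSubring (Localization.AtPrime Q))) e
  -- Step 4: `P'` is generated by `#Y ≤ dim A_P = dim A'_{P'}` elements; count dimensions.
  let Y' : Finset A'.toSubring := (Finset.univ : Finset Y).image w
  have hY' : P' = Ideal.span (Y' : Set A'.toSubring) := by
    rw [hP'J', hJ'def]
    congr 1
    simp only [Y', Finset.coe_image, Finset.coe_univ, Set.image_univ]
  have hY'card : (Y'.card : WithBot ℕ∞) ≤ ringKrullDim (Localization.AtPrime P') := by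
    rw [hdimP, ← IsRegularLocalRing.spanFinrank_maximalIdeal (R := AP)]
    have : Y'.card ≤ Y.card :=
      Finset.card_image_le.trans (by rw [Finset.card_univ, Fintype.card_coe])
    exact_mod_cast this.trans hYcard
  exact ⟨A', hA'O, hAA', hA'fg,
    isRegularLocalRing_localization_of_quotient P' Q' hP'Q' Y' hY' hY'card hregSQ⟩

end final

/-! ### Thm. 1.1: the induction on the rank (§3.1, first half) -/

/-- DISCHARGE of `NovacoskiSpivakovsky2014` — **Novacoski–Spivakovsky 2014, Thm. 1.1** for the
category of local domains essentially of finite type over a field: if every rank-one valuation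
ring admits relative local uniformization, so does every valuation ring. Novacoski–Spivakovsky's
induction on the rank (§3.1): rank `0`: `relLocalUniformization_top`; rank `1`: the hypothesis
via `nonempty_rankOne_of_overrings`; rank `≥ 2`: decompose `ν = ν₁ ∘ ν₂` along an intermediate
overring `O < O₁ < K`, apply the induction hypothesis to `ν₁` (`card_overrings_ofPrime_lt`) and
to the restrictions of `ν₂` (`card_overrings_residue_lt`, `card_overrings_comap_le`), then
Cor. 2.14 (`novacoskiSpivakovsky2014_cor214`), Cor. 2.17 (`novacoskiSpivakovsky2014_cor217`)
and the final step of §3.1 (`novacoskiSpivakovsky2014_step`); the rank is finite by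
`finite_overrings_of_fg`. [cite: NovacoskiSpivakovsky2014, Thm. 1.1] -/
theorem NovacoskiSpivakovsky2014_holds : NovacoskiSpivakovsky2014 := by
  intro k _ hrank1 K _ _ O
  suffices main : ∀ (n : ℕ) (K : Type) [Field K] [Algebra k K] (O : ValuationSubring K),
      Finite {S : ValuationSubring K // O ≤ S} →
      Nat.card {S : ValuationSubring K // O ≤ S} = n → RelLocalUniformization k K O by
    intro R hR hfrac hRO
    have hk : ∀ c : k, algebraMap k K c ∈ O := fun c => hRO (R.algebraMap_mem c)
    haveI := hfrac
    have hfin := finite_overrings_of_fg O hk R hR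
    exact main _ K O hfin rfl R hR hfrac hRO
  intro n
  induction n using Nat.strong_induction_on with
  | _ n ih => ?_
  intro K _ _ O hfin hn
  -- case analysis on the overrings of `O`
  by_cases htop : O = ⊤
  · subst htop; exact relLocalUniformization_top
  by_cases h2 : ∀ S : ValuationSubring K, O ≤ S → S = O ∨ S = ⊤
  · exact hrank1 K O (nonempty_rankOne_of_overrings O htop h2)
  push Not at h2
  obtain ⟨O₁, hO, hne, hne_top⟩ := h2
  -- induction hypothesis for `ν₁`
  have ih₁ : RelLocalUniformization k K O₁ := by
    have hlt : Nat.card {S : ValuationSubring K // O₁ ≤ S} < n := by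
      rw [← hn, ← ValuationSubring.ofPrime_idealOfLE O O₁ hO]
      exact card_overrings_ofPrime_lt O _ (idealOfLE_ne_maximalIdeal O O₁ hO hne)
    haveI : Finite {S : ValuationSubring K // O₁ ≤ S} := by
      rw [← ValuationSubring.ofPrime_idealOfLE O O₁ hO]; infer_instance
    exact ih _ hlt K O₁ this rfl
  -- induction hypothesis for the restrictions of `ν₂`
  have ih₂ : ∀ (κ : Type) [Field κ] [Algebra k κ] (ι : κ →+* ResidueField O₁),
      RelLocalUniformization k κ ((residueValuationSubring O O₁ hO).comap ι) := by
    intro κ _ _ ι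
    have hlt2 := card_overrings_residue_lt O O₁ hO hne_top
    have hle := card_overrings_comap_le (residueValuationSubring O O₁ hO) ι
    exact ih _ (hn ▸ lt_of_le_of_lt hle hlt2) κ _ inferInstance rfl
  -- the three steps
  intro R hR hfrac hRO
  obtain ⟨A₁, hA₁, hRA₁, hA₁fg, hreg₁⟩ :=
    novacoskiSpivakovsky2014_cor214 O O₁ hO R hR hfrac hRO (ih₁ R hR hfrac (hRO.trans hO))
  haveI := hfrac
  haveI hfrac₁ : IsFractionRing A₁ K := isFractionRing_subalgebra_of_le R A₁ hRA₁
  -- the input of Cor. 2.17 from the induction hypothesis for `ν₂` on `κ = Frac φ(A₁)`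
  have ih₂' : ∀ (κ : Type) [Field κ] [Algebra k κ] (ι : κ →+* ResidueField O₁) (φ : A₁ →ₐ[k] κ),
      (∀ a : A₁, ι (φ a) = residue O₁ ⟨(a : K), (hA₁.trans hO) a.2⟩) →
      IsFractionRing φ.range κ →
      ∃ (B : Subalgebra k κ)
        (hB : B.toSubring ≤ ((residueValuationSubring O O₁ hO).comap ι).toSubring),
        φ.range ≤ B ∧ B.FG ∧
        IsRegularLocalRing (Localization.AtPrime
          ((maximalIdeal ((residueValuationSubring O O₁ hO).comap ι)).comap
            (Subring.inclusion hB))) := by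
    intro κ _ _ ι φ hφ hfr
    have hfg : φ.range.FG := by
      have h := ((Subalgebra.fg_top A₁).mpr hA₁fg).map φ
      rwa [Algebra.map_top] at h
    have hle : φ.range.toSubring ≤ ((residueValuationSubring O O₁ hO).comap ι).toSubring := by
      intro z hz
      obtain ⟨a, rfl⟩ := (AlgHom.mem_range φ).mp (show z ∈ φ.range from hz)
      change φ a ∈ (residueValuationSubring O O₁ hO).comap ι
      rw [ValuationSubring.mem_comap, hφ]
      exact (residue_mem_residueValuationSubring_iff O O₁ hO _).mpr (hA₁ a.2)
    exact ih₂ κ ι φ.range hfg hfr hle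
  obtain ⟨A₂, hA₂, hA₁₂, hA₂fg, hreg₂, hreg₂'⟩ :=
    novacoskiSpivakovsky2014_cor217 O O₁ hO A₁ hA₁ hA₁fg hfrac₁ hreg₁ ih₂'
  haveI hfrac₂ : IsFractionRing A₂ K := isFractionRing_subalgebra_of_le A₁ A₂ hA₁₂
  obtain ⟨A₃, hA₃, hA₂₃, hA₃fg, hreg₃⟩ :=
    novacoskiSpivakovsky2014_step O O₁ hO A₂ hA₂ hA₂fg hfrac₂ hreg₂ hreg₂'
  exact ⟨A₃, hA₃, hRA₁.trans (hA₁₂.trans hA₂₃), hA₃fg, hreg₃⟩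

end Literature.AlgebraicGeometry.Resolution

end
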